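import Literature.Probability.LatticeModels.AizenmanWickBoundWalks
import HarnessLib

/-!
# Proof of Aizenman 1982, Proposition 12.1 (`aizenman_wickDeviation_le_finite`)

Topic `Literature/Probability/LatticeModels`, namespace `Literature.Probability.LatticeModels`.
Discharge of the named fact `aizenman_wickDeviation_le_finite` of `AizenmanWickBound.lean`
(M. Aizenman, *Geometric analysis of `φ⁴` fields and Ising models*, Comm. Math. Phys. **86** (1982),
Prop. 12.1, upper bound of (12.3): `|S_{2n} - G_{2n}| ≤ (3/2) R_{2n}`), following the printed proof
(§12, pp. 37–38, (12.5)–(12.7)) through the random-walk representation of §9, realised by the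
deterministic exploration of `CurrentExploration.lean` / `CurrentExplorationWeights.lean`:

* Part A (one ordering of the points; file `AizenmanWickBoundWalks`). For an ordering `τ` of the `2k` (distinct) points, pair the
  consecutive points, orient each pair by index, and explore the `j`-th independent current (sources
  the `j`-th pair) from its lower point to its higher point. By locality and the weight factorisation
  (Prop. 9.2/9.3, Lemma 9.2) and super-multiplicativity (Lemma 9.3, (9.12)), the tuples of walks with
  pairwise disjoint touched sets ("compatible") contribute at most `Z^{k-1}` times the weight of the
  joint cylinder inside `{∂n = A}`; the other tuples have two walks whose touched sets meet, hence two
  clusters which meet, which costs `Z² |U₄|/2` for that pair of pairs (Prop. 5.1 (5.2), Prop. 9.1):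
  `prod_ecurrentSum_pair_mul_le` — the current form of (12.5)–(12.7) for one `τ`.
* Part B (summing over orderings; file `AizenmanWickBoundWalks`). A current lies in the joint cylinder of a compatible tuple for at
  most the `2ᵏ k!` orderings inducing one and the same pairing (locality + target change determine the
  pairing from the current): `sum_sum_good_Jsum_le`.
* Part C. The combinatorial identity turning `∑_τ ∑_{j<j'}` into `(3/2) · wickRemainder`
  (`sum_sum_sum_pairTerm_eq`; the fibres of "values on the last four positions" are counted, not
  constructed).
* Part E₁. The injective case in terms of the normalised current sums `Sf K A = Z_K[A]/Z_K[∅]`,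
  `T2`, `C4` (`pairingSum_le_of_injective`), valid for edge-dependent couplings `K ≥ 0`.
* Part D. Coincident points ("easily reduced", p. 37): the pendant graph `pendantGraph G x` (one new
  vertex per index, joined to its point), whose pendant-vertex correlations are `t^{#}` times those
  of the points (`Sf_pendant`, `T2_pendant`, `pairingSum_pendant`, `C4_pendant`); the injective case
  on the pendant graph is the general case on `G` (`pairingSum_le`).
* Part E₂. The dictionary to `isingMeasure G univ β 0 .free` and `aizenman_wickDeviation_le_finite_holds`.

## References

* M. Aizenman, Comm. Math. Phys. 86 (1982) 1–48: Prop. 5.1 (5.2), §9 (Prop. 9.1–9.3, Lemmas 9.1–9.3,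
  (9.12)–(9.16)), §12 Prop. 12.1 and its proof (12.5)–(12.7) [AizenmanCMP1982].
* M. Aizenman, CDM 2020 (arXiv:2112.04248), Prop. 7.2 [AizenmanCDM2020]; R. Panis, arXiv:2309.05797,
  Prop. 4.6, Prop. 4.7 [Panis2023Triviality].
-/

noncomputable section

open MeasureTheory Finset
open scoped symmDiff ENNReal Nat

namespace Literature.Probability.LatticeModels

variable {V : Type*} [Fintype V] [DecidableEq V] {G : SimpleGraph V} [DecidableRel G.Adj]

open Current

/-! ### Part C. From orderings and pairs of pairs to `wickRemainder` -/

section PartC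

variable {α : Type*}

/-- Permuting the blocks `{2j, 2j+1}` of `{0,…,2k-1}` by a permutation of `{0,…,k-1}`. [folklore] -/
def blockPerm (k : ℕ) (σ : Equiv.Perm (Fin k)) : Equiv.Perm (Fin (2 * k)) :=
  (pairIdx k).symm.trans ((Equiv.prodCongr σ (Equiv.refl (Fin 2))).trans (pairIdx k))

/-- `blockPerm` on a block. [folklore] -/
@[simp] theorem blockPerm_pairIdx {k : ℕ} (σ : Equiv.Perm (Fin k)) (j : Fin k) (c : Fin 2) :
    blockPerm k σ (pairIdx k (j, c)) = pairIdx k (σ j, c) := by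
  simp [blockPerm]

/-- The summand attached to an ordering `τ` and a pair of blocks `(j, j')`: the two-point functions of
the other blocks times a four-point weight of the two blocks. [folklore] -/
def pairTerm (S : α → α → ℝ) (U : (Fin 4 → α) → ℝ) {k : ℕ} (x : Fin (2 * k) → α) (j j' : Fin k)
    (τ : Equiv.Perm (Fin (2 * k))) : ℝ :=
  (∏ i ∈ (Finset.univ.erase j).erase j', S (x (τ (pairIdx k (i, 0)))) (x (τ (pairIdx k (i, 1))))) *
    U ![x (τ (pairIdx k (j, 0))), x (τ (pairIdx k (j, 1))), x (τ (pairIdx k (j', 0))), x (τ (pairIdx k (j', 1)))]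

/-- Relabelling the blocks: `pairTerm j j' (τ ∘ blockPerm σ) = pairTerm (σ j) (σ j') τ`. [folklore] -/
theorem pairTerm_mul_blockPerm (S : α → α → ℝ) (U : (Fin 4 → α) → ℝ) {k : ℕ} (x : Fin (2 * k) → α)
    (σ : Equiv.Perm (Fin k)) (j j' : Fin k) (τ : Equiv.Perm (Fin (2 * k))) :
    pairTerm S U x j j' (τ * blockPerm k σ) = pairTerm S U x (σ j) (σ j') τ := by
  unfold pairTerm
  simp only [Equiv.Perm.mul_apply, blockPerm_pairIdx]
  congr 1
  have himg : ((Finset.univ.erase j).erase j').image σ = (Finset.univ.erase (σ j)).erase (σ j') := by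
    ext i'
    simp only [Finset.mem_image, Finset.mem_erase, Finset.mem_univ, and_true, ne_eq]
    constructor
    · rintro ⟨i, ⟨hi1, hi2⟩, rfl⟩
      exact ⟨fun h => hi1 (σ.injective h), fun h => hi2 (σ.injective h)⟩
    · rintro ⟨h1, h2⟩
      refine ⟨σ.symm i', ⟨fun h => h1 ?_, fun h => h2 ?_⟩, σ.apply_symm_apply i'⟩
      · rw [← h, Equiv.apply_symm_apply]
      · rw [← h, Equiv.apply_symm_apply]
  rw [← himg, Finset.prod_image (fun i _ i₂ _ h => σ.injective h)]

/-- **The sum over orderings of `pairTerm j j'` does not depend on the pair of blocks.** [folklore] -/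
theorem sum_pairTerm_eq (S : α → α → ℝ) (U : (Fin 4 → α) → ℝ) {k : ℕ} (x : Fin (2 * k) → α)
    (σ : Equiv.Perm (Fin k)) (j j' : Fin k) :
    ∑ τ, pairTerm S U x (σ j) (σ j') τ = ∑ τ, pairTerm S U x j j' τ := by
  simp_rw [← pairTerm_mul_blockPerm S U x σ j j']
  exact Equiv.sum_comp (Equiv.mulRight (blockPerm k σ)) (pairTerm S U x j j')

/-- Two distinct elements can be moved to two prescribed distinct elements by a permutation. [folklore] -/
theorem exists_perm_apply_eq {k : ℕ} {a b j j' : Fin k} (hab : a ≠ b) (hjj' : j ≠ j') :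
    ∃ σ : Equiv.Perm (Fin k), σ a = j ∧ σ b = j' := by
  classical
  refine ⟨(Equiv.swap a j).trans (Equiv.swap (Equiv.swap a j b) j'), ?_, ?_⟩
  · simp only [Equiv.trans_apply, Equiv.swap_apply_left]
    by_cases hbj : b = j
    · subst hbj
      rw [Equiv.swap_apply_right, Equiv.swap_apply_of_ne_of_ne hab.symm hjj']
    · rw [Equiv.swap_apply_of_ne_of_ne hab.symm hbj, Equiv.swap_apply_of_ne_of_ne (Ne.symm hbj) hjj']
  · simp only [Equiv.trans_apply, Equiv.swap_apply_left]

/-! #### The last two blocks: decomposition over four-element subsets -/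

section LastBlocks

variable (m : ℕ)

/-- The block `m` of `Fin (m+2)`. [folklore] -/
def blkA : Fin (m + 2) := ⟨m, by omega⟩

/-- The block `m+1` of `Fin (m+2)`. [folklore] -/
def blkB : Fin (m + 2) := ⟨m + 1, by omega⟩

/-- `blkA ≠ blkB`. [folklore] -/
theorem blkA_ne_blkB : blkA m ≠ blkB m := by simp [blkA, blkB, Fin.ext_iff]

/-- The positions: first the `2m` positions of the blocks `< m`, then the four positions of the last two
blocks. [folklore] -/
def posEquiv : Fin (2 * m) ⊕ Fin 4 ≃ Fin (2 * (m + 2)) :=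
  finSumFinEquiv.trans (finCongr (by ring))

/-- Values of `posEquiv` on the first summand. [folklore] -/
theorem posEquiv_inl_val (j : Fin (2 * m)) : (posEquiv m (Sum.inl j) : ℕ) = j := rfl

/-- Values of `posEquiv` on the second summand. [folklore] -/
theorem posEquiv_inr_val (c : Fin 4) : (posEquiv m (Sum.inr c) : ℕ) = 2 * m + c := rfl

/-- `posEquiv` on the first summand preserves the block structure. [folklore] -/
theorem posEquiv_inl (i : Fin m) (c : Fin 2) :
    posEquiv m (Sum.inl (pairIdx m (i, c))) = pairIdx (m + 2) (Fin.castLE (by omega) i, c) := by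
  apply Fin.ext
  rw [posEquiv_inl_val, pairIdx_apply_val, pairIdx_apply_val, Fin.val_castLE]

/-- `posEquiv` on the second summand: the four positions of the last two blocks. [folklore] -/
theorem posEquiv_inr (c : Fin 4) :
    posEquiv m (Sum.inr c) = ![pairIdx (m + 2) (blkA m, 0), pairIdx (m + 2) (blkA m, 1),
      pairIdx (m + 2) (blkB m, 0), pairIdx (m + 2) (blkB m, 1)] c := by
  apply Fin.ext
  rw [posEquiv_inr_val]
  fin_cases c <;> simp [pairIdx_apply_val, blkA, blkB] <;> omega

/-- The blocks other than the last two are the `castLE i`, `i < m`. [folklore] -/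
theorem erase_erase_eq_image :
    (Finset.univ.erase (blkA m)).erase (blkB m) = Finset.univ.image (Fin.castLE (n := m) (m := m + 2) (by omega)) := by
  ext j
  simp only [Finset.mem_erase, Finset.mem_univ, and_true, Finset.mem_image, true_and, blkA, blkB, ne_eq,
    Fin.ext_iff, Fin.val_castLE]
  constructor
  · rintro ⟨h1, h2⟩
    exact ⟨⟨j, by omega⟩, rfl⟩
  · rintro ⟨i, hi⟩
    omega

variable {m}
variable (s : {s : Finset (Fin (2 * (m + 2))) // s.card = 4})

/-- `2m = 2(m+2) - 4`. [folklore] -/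
theorem two_mul_eq_sub : 2 * m = 2 * (m + 2) - 4 := by omega

/-- The tree's `splitEquiv` (complement of `s` increasingly, then `s` increasingly) on `Fin (2m) ⊕ Fin 4`. [folklore] -/
def splitEquiv' : Fin (2 * m) ⊕ Fin 4 ≃ Fin (2 * (m + 2)) :=
  (Equiv.sumCongr (finCongr (two_mul_eq_sub (m := m))) (Equiv.refl (Fin 4))).trans (splitEquiv s)

/-- `splitEquiv'` on the second summand enumerates `s`. [folklore] -/
theorem splitEquiv'_inr (c : Fin 4) : splitEquiv' s (Sum.inr c) = s.1.orderEmbOfFin s.2 c := by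
  simp [splitEquiv', splitEquiv_inr]

/-- `splitEquiv'` on the first summand lands in the complement of `s`. [folklore] -/
theorem splitEquiv'_inl_not_mem (i : Fin (2 * m)) : splitEquiv' s (Sum.inl i) ∉ s.1 := by
  have h : splitEquiv' s (Sum.inl i) = s.1ᶜ.orderEmbOfFin (card_compl_of_card_eq_four s) (finCongr (two_mul_eq_sub (m := m)) i) := by
    simp [splitEquiv', splitEquiv_inl]
  rw [h]
  exact Finset.mem_compl.mp (Finset.orderEmbOfFin_mem _ _ _)

/-- The remaining `2m` points, read along `splitEquiv'` (a copy of `removeFour₂ x s` indexed by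
`Fin (2m)` rather than `Fin (2(m+2-2))`, see `pairingSum_remPts`). [folklore] -/
def remPts (x : Fin (2 * (m + 2)) → α) : Fin (2 * m) → α := fun i => x (splitEquiv' s (Sum.inl i))

/-- `remPts` is `removeFour` along a cast. [folklore] -/
theorem remPts_eq (x : Fin (2 * (m + 2)) → α) :
    remPts s x = removeFour x s ∘ Fin.cast (two_mul_eq_sub (m := m)) := by
  funext i
  have h : splitEquiv' s (Sum.inl i) = s.1ᶜ.orderEmbOfFin (card_compl_of_card_eq_four s) (finCongr (two_mul_eq_sub (m := m)) i) := by
    simp [splitEquiv', splitEquiv_inl]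
  rw [remPts, h]
  rfl

/-- Pairing sums do not see a cast of the index type. [folklore] -/
theorem pairingSum_comp_cast (S : α → α → ℝ) {N n₁ n₂ : ℕ} (f : Fin N → α) (h₁ : 2 * n₁ = N) (h₂ : 2 * n₂ = N)
    (e : n₁ = n₂) : pairingSum S n₁ (f ∘ Fin.cast h₁) = pairingSum S n₂ (f ∘ Fin.cast h₂) := by
  subst e; rfl

/-- `pairingSum S (m+2-2) (removeFour₂ x s) = pairingSum S m (remPts s x)`. [folklore] -/
theorem pairingSum_remPts (S : α → α → ℝ) (x : Fin (2 * (m + 2)) → α) :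
    pairingSum S (m + 2 - 2) (removeFour₂ x s) = pairingSum S m (remPts s x) := by
  rw [remPts_eq]
  exact pairingSum_comp_cast S (removeFour x s) (two_mul_sub_two (m + 2)) (two_mul_eq_sub (m := m)) (by omega)

/-- The orderings built from a permutation of the remaining positions and one of the four last positions. [folklore] -/
def psiMap (q : Equiv.Perm (Fin (2 * m)) × Equiv.Perm (Fin 4)) : Equiv.Perm (Fin (2 * (m + 2))) :=
  (posEquiv m).symm.trans ((Equiv.sumCongr q.1 q.2).trans (splitEquiv' s))

/-- `psiMap` on a position of a block `< m`. [folklore] -/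
theorem psiMap_pairIdx_castLE (q : Equiv.Perm (Fin (2 * m)) × Equiv.Perm (Fin 4)) (i : Fin m) (c : Fin 2) :
    psiMap s q (pairIdx (m + 2) (Fin.castLE (by omega) i, c)) = splitEquiv' s (Sum.inl (q.1 (pairIdx m (i, c)))) := by
  rw [psiMap, Equiv.trans_apply, Equiv.trans_apply, ← posEquiv_inl, Equiv.symm_apply_apply]
  rfl

/-- `psiMap` on the four last positions. [folklore] -/
theorem psiMap_last (q : Equiv.Perm (Fin (2 * m)) × Equiv.Perm (Fin 4)) (c : Fin 4) :
    psiMap s q (![pairIdx (m + 2) (blkA m, 0), pairIdx (m + 2) (blkA m, 1),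
      pairIdx (m + 2) (blkB m, 0), pairIdx (m + 2) (blkB m, 1)] c) = s.1.orderEmbOfFin s.2 (q.2 c) := by
  rw [psiMap, Equiv.trans_apply, Equiv.trans_apply, ← posEquiv_inr, Equiv.symm_apply_apply]
  exact splitEquiv'_inr s (q.2 c)

/-- `psiMap` is injective. [folklore] -/
theorem psiMap_injective : Function.Injective (psiMap s) := by
  rintro ⟨ρ, π⟩ ⟨ρ', π'⟩ h
  have hρ : ∀ i, ρ i = ρ' i := fun i => by
    have := congrArg (fun e => e (posEquiv m (Sum.inl i))) h
    simp only [psiMap, Equiv.trans_apply, Equiv.symm_apply_apply, Equiv.sumCongr_apply, Sum.map_inl] at this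
    exact Sum.inl_injective ((splitEquiv' s).injective this)
  have hπ : ∀ c, π c = π' c := fun c => by
    have := congrArg (fun e => e (posEquiv m (Sum.inr c))) h
    simp only [psiMap, Equiv.trans_apply, Equiv.symm_apply_apply, Equiv.sumCongr_apply, Sum.map_inr] at this
    exact Sum.inr_injective ((splitEquiv' s).injective this)
  exact Prod.ext (Equiv.ext hρ) (Equiv.ext hπ)

/-- The set of the four values of an ordering on the last four positions. [folklore] -/
def lastSet (τ : Equiv.Perm (Fin (2 * (m + 2)))) : Finset (Fin (2 * (m + 2))) :=
  Finset.univ.image fun c : Fin 4 => τ (![pairIdx (m + 2) (blkA m, 0), pairIdx (m + 2) (blkA m, 1),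
      pairIdx (m + 2) (blkB m, 0), pairIdx (m + 2) (blkB m, 1)] c)

/-- The four last positions are distinct. [folklore] -/
theorem lastPos_injective : Function.Injective (![pairIdx (m + 2) (blkA m, 0), pairIdx (m + 2) (blkA m, 1),
      pairIdx (m + 2) (blkB m, 0), pairIdx (m + 2) (blkB m, 1)] : Fin 4 → Fin (2 * (m + 2))) := by
  intro c c' h
  rw [← posEquiv_inr, ← posEquiv_inr] at h
  exact Sum.inr_injective ((posEquiv m).injective h)

/-- `lastSet τ` has four elements. [folklore] -/
theorem card_lastSet (τ : Equiv.Perm (Fin (2 * (m + 2)))) : (lastSet τ).card = 4 := by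
  rw [lastSet, Finset.card_image_of_injective _ (fun c c' h => lastPos_injective (τ.injective h))]
  simp

/-- `psiMap s q` sends the last four positions onto `s`. [folklore] -/
theorem lastSet_psiMap (q : Equiv.Perm (Fin (2 * m)) × Equiv.Perm (Fin 4)) : lastSet (psiMap s q) = s.1 := by
  apply Finset.eq_of_subset_of_card_le
  · intro i hi
    rw [lastSet, Finset.mem_image] at hi
    obtain ⟨c, -, rfl⟩ := hi
    rw [psiMap_last]
    exact Finset.orderEmbOfFin_mem _ _ _
  · rw [s.2, card_lastSet]

/-- **The orderings with a given set of values on the last four positions are exactly the `psiMap s q`**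
(a counting argument: the images are disjointly contained in the fibres and fill up all of
`(2m+4)! = C(2m+4,4) · (2m)! · 4!`). [folklore] -/
theorem filter_lastSet_eq_image :
    Finset.univ.filter (fun τ : Equiv.Perm (Fin (2 * (m + 2))) => lastSet τ = s.1) = Finset.univ.image (psiMap s) := by
  classical
  -- images sit inside fibres
  have hsub : ∀ s' : {s : Finset (Fin (2 * (m + 2))) // s.card = 4},
      Finset.univ.image (psiMap s') ⊆ Finset.univ.filter (fun τ => lastSet τ = s'.1) := by
    intro s' τ hτ
    rw [Finset.mem_image] at hτ
    obtain ⟨q, -, rfl⟩ := hτ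
    rw [Finset.mem_filter]
    exact ⟨Finset.mem_univ _, lastSet_psiMap s' q⟩
  have hcard_img : ∀ s' : {s : Finset (Fin (2 * (m + 2))) // s.card = 4},
      (Finset.univ.image (psiMap s')).card = (2 * m)! * 4 ! := by
    intro s'
    rw [Finset.card_image_of_injective _ (psiMap_injective s'), Finset.card_univ, Fintype.card_prod,
      Fintype.card_perm, Fintype.card_perm, Fintype.card_fin, Fintype.card_fin]
  -- the total counts agree
  have htot : ∑ s' : {s : Finset (Fin (2 * (m + 2))) // s.card = 4},
      (Finset.univ.filter (fun τ : Equiv.Perm (Fin (2 * (m + 2))) => lastSet τ = s'.1)).card = (2 * (m + 2))! := by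
    have h := (Finset.card_eq_sum_card_fiberwise (s := (Finset.univ : Finset (Equiv.Perm (Fin (2 * (m + 2))))))
      (t := (Finset.univ : Finset {s : Finset (Fin (2 * (m + 2))) // s.card = 4}))
      (f := fun τ => (⟨lastSet τ, card_lastSet τ⟩ : {s : Finset (Fin (2 * (m + 2))) // s.card = 4}))
      fun _ _ => Finset.mem_univ _).symm
    rw [Finset.card_univ, Fintype.card_perm, Fintype.card_fin] at h
    rw [← h]
    refine Finset.sum_congr rfl fun s' _ => ?_
    congr 1
    ext τ
    simp only [Finset.mem_filter, Finset.mem_univ, true_and, Subtype.ext_iff]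
  have htot' : ∑ s' : {s : Finset (Fin (2 * (m + 2))) // s.card = 4},
      (Finset.univ.image (psiMap s')).card = (2 * (m + 2))! := by
    simp_rw [hcard_img]
    rw [Finset.sum_const, Finset.card_univ, Fintype.card_finset_len, Fintype.card_fin, smul_eq_mul]
    have h4 : 4 ≤ 2 * (m + 2) := by omega
    have := Nat.choose_mul_factorial_mul_factorial h4
    rw [show 2 * (m + 2) - 4 = 2 * m by omega] at this
    calc (2 * (m + 2)).choose 4 * ((2 * m)! * 4 !) = (2 * (m + 2)).choose 4 * 4 ! * (2 * m)! := by ring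
      _ = (2 * (m + 2))! := this
  -- hence every fibre has the cardinality of the image, and they coincide
  have hle : ∀ s' ∈ (Finset.univ : Finset {s : Finset (Fin (2 * (m + 2))) // s.card = 4}),
      (Finset.univ.image (psiMap s')).card ≤ (Finset.univ.filter (fun τ => lastSet τ = s'.1)).card :=
    fun s' _ => Finset.card_le_card (hsub s')
  have heq := (Finset.sum_eq_sum_iff_of_le hle).mp (htot'.trans htot.symm) s (Finset.mem_univ _)
  exact (Finset.eq_of_subset_of_card_le (hsub s) (le_of_eq heq.symm)).symm

/-- **`pairTerm` on `psiMap s q`**: the product of the two-point functions of the remaining pairs of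
`removeFour₂ x s` along `q.1`, times `U` of the four selected points (in the order `q.2`). [folklore] -/
theorem pairTerm_psiMap (S : α → α → ℝ) (U : (Fin 4 → α) → ℝ) (x : Fin (2 * (m + 2)) → α)
    (q : Equiv.Perm (Fin (2 * m)) × Equiv.Perm (Fin 4)) :
    pairTerm S U x (blkA m) (blkB m) (psiMap s q) =
      (∏ i : Fin m, S (remPts s x (q.1 (pairIdx m (i, 0)))) (remPts s x (q.1 (pairIdx m (i, 1))))) *
        U (restrictFour x s ∘ q.2) := by
  unfold pairTerm
  congr 1
  · rw [erase_erase_eq_image, Finset.prod_image (fun i _ i' _ h => Fin.castLE_injective _ h)]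
    refine Finset.prod_congr rfl fun i _ => ?_
    rw [psiMap_pairIdx_castLE, psiMap_pairIdx_castLE]
    rfl
  · congr 1
    funext c
    have h0 := psiMap_last s q 0
    have h1 := psiMap_last s q 1
    have h2 := psiMap_last s q 2
    have h3 := psiMap_last s q 3
    simp only [Matrix.cons_val_zero, Matrix.cons_val_one] at h0 h1
    fin_cases c
    · simp only [Function.comp_apply]
      rw [h0]; rfl
    · simp only [Function.comp_apply]
      rw [h1]; rfl
    · simp only [Function.comp_apply]
      change x ((psiMap s q) (pairIdx (m + 2) (blkB m, 0))) = restrictFour x s (q.2 2)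
      have : (![pairIdx (m + 2) (blkA m, 0), pairIdx (m + 2) (blkA m, 1),
          pairIdx (m + 2) (blkB m, 0), pairIdx (m + 2) (blkB m, 1)] : Fin 4 → Fin (2 * (m + 2))) 2 =
          pairIdx (m + 2) (blkB m, 0) := rfl
      rw [← this, h2]; rfl
    · simp only [Function.comp_apply]
      change x ((psiMap s q) (pairIdx (m + 2) (blkB m, 1))) = restrictFour x s (q.2 3)
      have : (![pairIdx (m + 2) (blkA m, 0), pairIdx (m + 2) (blkA m, 1),
          pairIdx (m + 2) (blkB m, 0), pairIdx (m + 2) (blkB m, 1)] : Fin 4 → Fin (2 * (m + 2))) 3 =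
          pairIdx (m + 2) (blkB m, 1) := rfl
      rw [← this, h3]; rfl

/-- **The sum over orderings for the last two blocks** (decomposition by the set of values on the four
last positions): `∑_τ pairTerm = 4! · 2ᵐ m! · ∑_s U(x_s) 𝒢_m[S](x^{(s̸)})` for `U` symmetric. [folklore] -/
theorem sum_pairTerm_last_eq (S : α → α → ℝ) (U : (Fin 4 → α) → ℝ)
    (hU : ∀ (y : Fin 4 → α) (π : Equiv.Perm (Fin 4)), U (y ∘ π) = U y) (x : Fin (2 * (m + 2)) → α) :
    ∑ τ, pairTerm S U x (blkA m) (blkB m) τ =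
      (24 * (2 ^ m * m ! : ℝ)) * ∑ s : {s : Finset (Fin (2 * (m + 2))) // s.card = 4},
        U (restrictFour x s) * pairingSum S m (remPts s x) := by
  classical
  -- decompose by the fibre of `lastSet`
  rw [← Finset.sum_fiberwise Finset.univ (fun τ => (⟨lastSet τ, card_lastSet τ⟩ : {s : Finset (Fin (2 * (m + 2))) // s.card = 4}))
    (pairTerm S U x (blkA m) (blkB m)), Finset.mul_sum]
  refine Finset.sum_congr rfl fun s _ => ?_
  have hfib : (Finset.univ.filter fun τ : Equiv.Perm (Fin (2 * (m + 2))) =>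
      (⟨lastSet τ, card_lastSet τ⟩ : {s : Finset (Fin (2 * (m + 2))) // s.card = 4}) = s) =
      Finset.univ.image (psiMap s) := by
    rw [← filter_lastSet_eq_image]
    congr 1
    ext τ
    simp only [Subtype.ext_iff]
  rw [hfib, Finset.sum_image (fun q _ q' _ h => psiMap_injective s h)]
  simp_rw [pairTerm_psiMap, hU, Fintype.sum_prod_type, Finset.sum_const, Finset.card_univ, Fintype.card_perm,
    Fintype.card_fin, nsmul_eq_mul]
  have hps : ∑ ρ : Equiv.Perm (Fin (2 * m)), ∏ i : Fin m,
      S (remPts s x (ρ (pairIdx m (i, 0)))) (remPts s x (ρ (pairIdx m (i, 1)))) =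
      (2 ^ m * m ! : ℝ) * pairingSum S m (remPts s x) := by
    rw [pairingSum, ← mul_assoc, mul_inv_cancel₀ (by positivity), one_mul]
  rw [← Finset.mul_sum, ← Finset.sum_mul, hps]
  have h4 : ((4 ! : ℕ) : ℝ) = 24 := by norm_num [Nat.factorial]
  rw [h4]
  ring

/-- `2 ∑_j #{j' > j} = (m+2)(m+1)`: twice the number of pairs of blocks. [folklore] -/
theorem two_mul_sum_card_filter_gt (n : ℕ) :
    2 * ∑ j : Fin n, (Finset.univ.filter fun j' : Fin n => j < j').card = n * (n - 1) := by
  have h : ∀ j : Fin n, (Finset.univ.filter fun j' : Fin n => j < j').card = n - 1 - j := by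
    intro j
    rw [Finset.filter_lt_eq_Ioi, Fin.card_Ioi]
  simp_rw [h]
  rw [Fin.sum_univ_eq_sum_range (fun j => n - 1 - j) n, Finset.sum_range_reflect (fun j => j) n, mul_comm,
    Finset.sum_range_id_mul_two]

/-- **The conversion of `∑_τ ∑_{j<j'} pairTerm` into the `4`-subset form of Aizenman's remainder**
(the regrouping (12.5) → (12.6) of Aizenman 1982: "arranging the final expression in terms of the
vertices of `ω_a` and `ω_b`"): for `U` symmetric under permutations of its four arguments,
`∑_τ ∑_{j<j'} pairTerm_{j,j'}(τ) = 3 · 2^{m+2} (m+2)! · ∑_s U(x_s) 𝒢_m[S](x^{(s̸)})`. [cite: AizenmanCMP1982, proof of Prop. 12.1, (12.5)–(12.6)] -/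
theorem sum_sum_sum_pairTerm_eq (S : α → α → ℝ) (U : (Fin 4 → α) → ℝ)
    (hU : ∀ (y : Fin 4 → α) (π : Equiv.Perm (Fin 4)), U (y ∘ π) = U y) (x : Fin (2 * (m + 2)) → α) :
    ∑ τ : Equiv.Perm (Fin (2 * (m + 2))), ∑ j : Fin (m + 2), ∑ j' ∈ Finset.univ.filter (fun j' => j < j'),
        pairTerm S U x j j' τ =
      (3 * 2 ^ (m + 2) * (m + 2)! : ℝ) * ∑ s : {s : Finset (Fin (2 * (m + 2))) // s.card = 4},
        U (restrictFour x s) * pairingSum S (m + 2 - 2) (removeFour₂ x s) := by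
  rw [Finset.sum_comm]
  have hinner : ∀ j : Fin (m + 2), ∑ τ : Equiv.Perm (Fin (2 * (m + 2))), ∑ j' ∈ Finset.univ.filter (fun j' => j < j'),
      pairTerm S U x j j' τ = ((Finset.univ.filter fun j' : Fin (m + 2) => j < j').card : ℝ) *
        ∑ τ, pairTerm S U x (blkA m) (blkB m) τ := by
    intro j
    rw [Finset.sum_comm]
    rw [Finset.sum_congr rfl fun j' hj' => show ∑ τ, pairTerm S U x j j' τ = ∑ τ, pairTerm S U x (blkA m) (blkB m) τ from by
      obtain ⟨σ, hσa, hσb⟩ := exists_perm_apply_eq (blkA_ne_blkB m) (Finset.mem_filter.mp hj').2.ne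
      rw [← hσa, ← hσb]
      exact sum_pairTerm_eq S U x σ (blkA m) (blkB m)]
    rw [Finset.sum_const, nsmul_eq_mul]
  simp_rw [hinner]
  rw [← Finset.sum_mul, sum_pairTerm_last_eq S U hU x]
  simp_rw [pairingSum_remPts]
  have hN : (2 : ℝ) * ∑ j : Fin (m + 2), ((Finset.univ.filter fun j' : Fin (m + 2) => j < j').card : ℝ) =
      (m + 2 : ℝ) * (m + 1) := by
    have := two_mul_sum_card_filter_gt (m + 2)
    rw [show m + 2 - 1 = m + 1 by omega] at this
    exact_mod_cast this
  have hfac : ((m + 2)! : ℝ) = (m + 2) * (m + 1) * m ! := by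
    rw [Nat.factorial_succ, Nat.factorial_succ]; push_cast; ring
  rw [hfac, ← mul_assoc]
  congr 1
  have h2 : ∑ j : Fin (m + 2), ((Finset.univ.filter fun j' : Fin (m + 2) => j < j').card : ℝ) =
      (m + 2 : ℝ) * (m + 1) / 2 := by linarith
  rw [h2]
  ring

end LastBlocks

end PartC

/-! ### Part E₁. The injective case in terms of normalised current sums -/

section PartE1

variable (K : G.edgeFinset → ℝ)

/-- The normalised current sum `Z_K[A]/Z_K[∅]` (`= ⟨σ_A⟩` for the Ising model with couplings `K`). [cite: Panis2023Triviality, §4.1] -/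
def Sf (A : Finset V) : ℝ := wcurrentSum K A / wcurrentSum K ∅

/-- The two-point function `Z_K[{u} ∆ {v}]/Z_K[∅]`. [cite: Panis2023Triviality, §4.1] -/
def T2 (u v : V) : ℝ := Sf K ({u} ∆ {v})

/-- The Wick pairing of four points, `S(y₀y₁)S(y₂y₃) + S(y₀y₂)S(y₁y₃) + S(y₀y₃)S(y₁y₂)`. [folklore] -/
def M3 (T : V → V → ℝ) (y : Fin 4 → V) : ℝ :=
  T (y 0) (y 1) * T (y 2) (y 3) + T (y 0) (y 2) * T (y 1) (y 3) + T (y 0) (y 3) * T (y 1) (y 2)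

/-- The four-point Ursell function `U₄ = S₄ - 𝒢₂[S₂]` in terms of current sums. [cite: AizenmanCMP1982, Prop. 5.1] -/
def C4 (y : Fin 4 → V) : ℝ := Sf K (oddSupport y) - M3 (T2 K) y

variable {K}

/-- `Sf K ≥ 0` for `K ≥ 0`. [folklore] -/
theorem Sf_nonneg (hK : ∀ e, 0 ≤ K e) (A : Finset V) : 0 ≤ Sf K A :=
  div_nonneg (wcurrentSum_nonneg hK A) (wcurrentSum_nonneg hK ∅)

/-- `Sf K ∅ = 1`. [folklore] -/
theorem Sf_empty (hK : ∀ e, 0 ≤ K e) : Sf K (∅ : Finset V) = 1 :=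
  div_self (wcurrentSum_empty_pos hK).ne'

/-- The two-point function is symmetric. [folklore] -/
theorem T2_comm (u v : V) : T2 K u v = T2 K v u := by
  unfold T2; rw [symmDiff_comm]

/-- `T2 K v v = 1`. [folklore] -/
theorem T2_self (hK : ∀ e, 0 ≤ K e) (v : V) : T2 K v v = 1 := by
  unfold T2; rw [symmDiff_self, Finset.bot_eq_empty, Sf_empty hK]

/-- `T2 K ≥ 0`. [folklore] -/
theorem T2_nonneg (hK : ∀ e, 0 ≤ K e) (u v : V) : 0 ≤ T2 K u v := Sf_nonneg hK _

omit [Fintype V] [DecidableEq V] in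
/-- Symmetry of the Wick pairing of four points under the three adjacent transpositions. [folklore] -/
theorem M3_comp_swap_adj {T : V → V → ℝ} (hT : ∀ u v, T u v = T v u) (y : Fin 4 → V) :
    M3 T (y ∘ Equiv.swap 0 1) = M3 T y ∧ M3 T (y ∘ Equiv.swap 1 2) = M3 T y ∧
      M3 T (y ∘ Equiv.swap 2 3) = M3 T y := by
  refine ⟨?_, ?_, ?_⟩ <;> simp only [M3, Function.comp_apply, Equiv.swap_apply_left, Equiv.swap_apply_right]
  · rw [Equiv.swap_apply_of_ne_of_ne (show (2 : Fin 4) ≠ 0 by decide) (show (2 : Fin 4) ≠ 1 by decide),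
      Equiv.swap_apply_of_ne_of_ne (show (3 : Fin 4) ≠ 0 by decide) (show (3 : Fin 4) ≠ 1 by decide),
      hT (y 1) (y 0)]
    ring
  · rw [Equiv.swap_apply_of_ne_of_ne (show (0 : Fin 4) ≠ 1 by decide) (show (0 : Fin 4) ≠ 2 by decide),
      Equiv.swap_apply_of_ne_of_ne (show (3 : Fin 4) ≠ 1 by decide) (show (3 : Fin 4) ≠ 2 by decide),
      hT (y 2) (y 1)]
    ring
  · rw [Equiv.swap_apply_of_ne_of_ne (show (0 : Fin 4) ≠ 2 by decide) (show (0 : Fin 4) ≠ 3 by decide),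
      Equiv.swap_apply_of_ne_of_ne (show (1 : Fin 4) ≠ 2 by decide) (show (1 : Fin 4) ≠ 3 by decide),
      hT (y 3) (y 2)]
    ring

omit [Fintype V] [DecidableEq V] in
/-- The Wick pairing of four points is symmetric under permutations (the adjacent transpositions
generate the symmetric group, `Equiv.Perm.mclosure_swap_castSucc_succ`). [folklore] -/
theorem M3_comp_perm {T : V → V → ℝ} (hT : ∀ u v, T u v = T v u) (y : Fin 4 → V) (π : Equiv.Perm (Fin 4)) :
    M3 T (y ∘ π) = M3 T y := by
  have hgen : ∀ i : Fin 3, ∀ y : Fin 4 → V, M3 T (y ∘ Equiv.swap i.castSucc i.succ) = M3 T y := by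
    intro i y
    obtain ⟨h01, h12, h23⟩ := M3_comp_swap_adj hT y
    obtain ⟨i, hi⟩ := i
    interval_cases i
    · exact h01
    · exact h12
    · exact h23
  have hmem : π ∈ Submonoid.closure (Set.range fun i : Fin 3 => Equiv.swap i.castSucc i.succ) := by
    rw [Equiv.Perm.mclosure_swap_castSucc_succ]; exact Submonoid.mem_top π
  induction hmem using Submonoid.closure_induction generalizing y with
  | mem σ hσ =>
    obtain ⟨i, rfl⟩ := hσ
    exact hgen i y
  | one => rfl
  | mul σ σ' _ _ ih ih' =>
    rw [Equiv.Perm.coe_mul, ← Function.comp_assoc, ih', ih]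

/-- `U₄` is symmetric under permutations of its four arguments. [folklore] -/
theorem C4_comp_perm (y : Fin 4 → V) (π : Equiv.Perm (Fin 4)) : C4 K (y ∘ π) = C4 K y := by
  unfold C4
  rw [oddSupport_comp_perm, M3_comp_perm T2_comm]

/-- The odd support of four points. [folklore] -/
theorem oddSupport_four (a b c d : V) : oddSupport ![a, b, c, d] = {a} ∆ ({b} ∆ ({c} ∆ {d})) := by
  have h4 : (![a, b, c, d] : Fin 4 → V) = Fin.cons a (Fin.cons b (Fin.cons c (Fin.cons d Fin.elim0))) := by
    funext i; fin_cases i <;> rfl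
  have h0 : oddSupport (Fin.elim0 : Fin 0 → V) = ∅ := by
    unfold oddSupport; simp
  rw [h4, oddSupport_cons, oddSupport_cons, oddSupport_cons, oddSupport_cons, h0]
  ext v
  simp only [Finset.mem_symmDiff, Finset.mem_singleton, Finset.notMem_empty]
  tauto

/-- `P ≤ Z[ab] Z[a'b'] < ∞`. [folklore] -/
theorem Pint_ne_top (hK : ∀ e, 0 ≤ K e) (a b a' b' : V) : Pint K a b a' b' ≠ ⊤ := by
  have hle : Pint K a b a' b' ≤ ecurrentSum K ({a} ∆ {b}) * ecurrentSum K ({a'} ∆ {b'}) := by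
    rw [← tsum_epairWeight]
    unfold Pint
    refine ENNReal.tsum_le_tsum fun p => ?_
    split_ifs
    · rw [mul_one]
    · rw [mul_zero]; exact zero_le
  exact ne_top_of_le_ne_top (ENNReal.mul_ne_top (ecurrentSum_ne_top hK _) (ecurrentSum_ne_top hK _)) hle

/-- **The random-current identity for `U₄` in normalised form**: `P(a,b,a',b')/Z² = -U₄(a,b,a',b')/2`
(Aizenman 1982, Prop. 5.1 (5.2); the tree's `Current.ursellFour_currentSum_identity`), together with
Lebowitz' sign `U₄ ≤ 0`. [cite: AizenmanCMP1982, Prop. 5.1, eq. (5.2)] -/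
theorem toReal_Pint_div_eq (hK : ∀ e, 0 ≤ K e) (a b a' b' : V) :
    (Pint K a b a' b').toReal / wcurrentSum K ∅ ^ 2 = -(C4 K ![a, b, a', b']) / 2 ∧ C4 K ![a, b, a', b'] ≤ 0 := by
  have hZ := wcurrentSum_empty_pos (V := V) hK (G := G)
  have hid : ecurrentSum K ({a} ∆ {b}) * ecurrentSum K ({a'} ∆ {b'}) +
        ecurrentSum K ({a} ∆ {a'}) * ecurrentSum K ({b} ∆ {b'}) +
        ecurrentSum K ({a} ∆ {b'}) * ecurrentSum K ({b} ∆ {a'}) =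
      ecurrentSum K ({a} ∆ ({b} ∆ ({a'} ∆ {b'}))) * ecurrentSum K ∅ + 2 * Pint K a b a' b' :=
    ursellFour_currentSum_identity hK a b a' b'
  have hP : Pint K a b a' b' ≠ ⊤ := Pint_ne_top hK a b a' b'
  have hr := congrArg ENNReal.toReal hid
  rw [ENNReal.toReal_add (by exact ENNReal.add_ne_top.mpr ⟨ENNReal.mul_ne_top (ecurrentSum_ne_top hK _) (ecurrentSum_ne_top hK _),
      ENNReal.mul_ne_top (ecurrentSum_ne_top hK _) (ecurrentSum_ne_top hK _)⟩)
      (ENNReal.mul_ne_top (ecurrentSum_ne_top hK _) (ecurrentSum_ne_top hK _)),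
    ENNReal.toReal_add (ENNReal.mul_ne_top (ecurrentSum_ne_top hK _) (ecurrentSum_ne_top hK _))
      (ENNReal.mul_ne_top (ecurrentSum_ne_top hK _) (ecurrentSum_ne_top hK _)),
    ENNReal.toReal_add (ENNReal.mul_ne_top (ecurrentSum_ne_top hK _) (ecurrentSum_ne_top hK _))
      (ENNReal.mul_ne_top (by simp) hP)] at hr
  simp only [ENNReal.toReal_mul, toReal_ecurrentSum hK, ENNReal.toReal_ofNat] at hr
  -- translate into `Sf`, `T2`, `C4`
  have hC : C4 K ![a, b, a', b'] = wcurrentSum K ({a} ∆ ({b} ∆ ({a'} ∆ {b'}))) / wcurrentSum K ∅ -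
      (wcurrentSum K ({a} ∆ {b}) / wcurrentSum K ∅ * (wcurrentSum K ({a'} ∆ {b'}) / wcurrentSum K ∅) +
        wcurrentSum K ({a} ∆ {a'}) / wcurrentSum K ∅ * (wcurrentSum K ({b} ∆ {b'}) / wcurrentSum K ∅) +
        wcurrentSum K ({a} ∆ {b'}) / wcurrentSum K ∅ * (wcurrentSum K ({b} ∆ {a'}) / wcurrentSum K ∅)) := by
    unfold C4 M3 T2 Sf
    simp only [Matrix.cons_val_zero, Matrix.cons_val_one, Matrix.cons_val, oddSupport_four]
  have hPdiv : (Pint K a b a' b').toReal / wcurrentSum K ∅ ^ 2 = -(C4 K ![a, b, a', b']) / 2 := by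
    rw [hC]
    field_simp
    nlinarith [hr]
  refine ⟨hPdiv, ?_⟩
  have : 0 ≤ (Pint K a b a' b').toReal / wcurrentSum K ∅ ^ 2 := div_nonneg ENNReal.toReal_nonneg (sq_nonneg _)
  rw [hPdiv] at this
  linarith

/-- Reorienting the two pairs permutes the four arguments of `U₄`. [folklore] -/
theorem abs_C4_wA_wB_eq {k : ℕ} (x : Fin (2 * k) → V) (τ : Equiv.Perm (Fin (2 * k))) (j j' : Fin k) :
    |C4 K ![wA x τ j, wB x τ j, wA x τ j', wB x τ j']| =
      |C4 K ![x (τ (pairIdx k (j, 0))), x (τ (pairIdx k (j, 1))), x (τ (pairIdx k (j', 0))), x (τ (pairIdx k (j', 1)))]| := by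
  unfold wA wB
  have hswap01 : ∀ a b c d : V, C4 K ![b, a, c, d] = C4 K ![a, b, c, d] := by
    intro a b c d
    have : (![b, a, c, d] : Fin 4 → V) = ![a, b, c, d] ∘ Equiv.swap 0 1 := by
      funext i; fin_cases i <;> rfl
    rw [this, C4_comp_perm]
  have hswap23 : ∀ a b c d : V, C4 K ![a, b, d, c] = C4 K ![a, b, c, d] := by
    intro a b c d
    have : (![a, b, d, c] : Fin 4 → V) = ![a, b, c, d] ∘ Equiv.swap 2 3 := by
      funext i; fin_cases i <;> rfl
    rw [this, C4_comp_perm]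
  rcases loIdx_hiIdx_eq (τ := τ) j with ⟨h0, h1⟩ | ⟨h0, h1⟩ <;>
    rcases loIdx_hiIdx_eq (τ := τ) j' with ⟨h0', h1'⟩ | ⟨h0', h1'⟩ <;> rw [h0, h1, h0', h1']
  · rw [hswap23]
  · rw [hswap01]
  · rw [hswap01, hswap23]

/-- `toReal` of a product of current sums. [folklore] -/
theorem toReal_prod_ecurrentSum (hK : ∀ e, 0 ≤ K e) {ι : Type*} (s : Finset ι) (A : ι → Finset V) :
    (∏ i ∈ s, ecurrentSum K (A i)).toReal = ∏ i ∈ s, wcurrentSum K (A i) := by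
  rw [ENNReal.toReal_prod]
  exact Finset.prod_congr rfl fun i _ => toReal_ecurrentSum hK (A i)

/-- A product of current sums is finite. [folklore] -/
theorem prod_ecurrentSum_ne_top (hK : ∀ e, 0 ≤ K e) {ι : Type*} (s : Finset ι) (A : ι → Finset V) :
    ∏ i ∈ s, ecurrentSum K (A i) ≠ ⊤ :=
  ENNReal.prod_ne_top fun i _ => ecurrentSum_ne_top hK (A i)

variable {rk : G.edgeFinset → ℕ}

/-- **The per-ordering inequality in real form** (Aizenman 1982, (12.5)–(12.7) for one `T`): with
`G(τ) = Z⁻¹ ∑_{compatible} Jsum` and `S_j = ⟨σ_{a_j}σ_{b_j}⟩`,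
`∏_j S_j ≤ G(τ)/Z + (1/2) ∑_{j<j'} pairTerm_{j,j'}(τ)` (`pairTerm` with `U = |U₄|`). [cite: AizenmanCMP1982, proof of Prop. 12.1, (12.5)–(12.7)] -/
theorem prod_T2_le_of_ordering (hK : ∀ e, 0 ≤ K e) (hrk : Function.Injective rk) {k : ℕ}
    (x : Fin (2 * k) → V) (τ : Equiv.Perm (Fin (2 * k))) :
    haveI := Classical.decPred (Good rk x τ)
    ∏ j, T2 K (x (τ (pairIdx k (j, 0)))) (x (τ (pairIdx k (j, 1)))) ≤
      (∑ δ : Fin k → XState G, if Good rk x τ δ then Jsum K x δ else 0).toReal / wcurrentSum K ∅ +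
        1 / 2 * ∑ j, ∑ j' ∈ Finset.univ.filter (fun j' => j < j'), pairTerm (T2 K) (fun y => |C4 K y|) x j j' τ := by
  classical
  set z : ℝ := wcurrentSum K ∅ with hz
  have hzpos : 0 < z := wcurrentSum_empty_pos hK
  have hENN := prod_ecurrentSum_pair_mul_le (K := K) (x := x) (τ := τ) hK hrk
  -- finiteness
  have hG : (∑ δ : Fin k → XState G, if Good rk x τ δ then Jsum K x δ else 0) ≠ ⊤ := by
    refine ENNReal.sum_ne_top.mpr fun δ _ => ?_
    split_ifs
    · refine ne_top_of_le_ne_top (ecurrentSum_ne_top hK (oddSupport x)) ?_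
      unfold Jsum ecurrentSum
      refine ENNReal.tsum_le_tsum fun m => ?_
      split_ifs with h1 h2 h2
      · exact le_rfl
      · exact absurd h1.1 h2
      · exact zero_le
      · exact le_rfl
    · exact ENNReal.zero_ne_top
  have hE : ∀ j j', (∏ i ∈ (Finset.univ.erase j).erase j', ecurrentSum K (pairSrc x τ i)) *
      Pint K (wA x τ j) (wB x τ j) (wA x τ j') (wB x τ j') ≠ ⊤ := fun j j' =>
    ENNReal.mul_ne_top (prod_ecurrentSum_ne_top hK _ _) (Pint_ne_top hK _ _ _ _)
  have hRHS : ecurrentSum K ∅ ^ k * (∑ δ : Fin k → XState G, if Good rk x τ δ then Jsum K x δ else 0) +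
      ecurrentSum K ∅ * ∑ j, ∑ j' ∈ Finset.univ.filter (fun j' => j < j'),
        (∏ i ∈ (Finset.univ.erase j).erase j', ecurrentSum K (pairSrc x τ i)) *
          Pint K (wA x τ j) (wB x τ j) (wA x τ j') (wB x τ j') ≠ ⊤ := by
    refine ENNReal.add_ne_top.mpr ⟨ENNReal.mul_ne_top (ENNReal.pow_ne_top (ecurrentSum_ne_top hK ∅)) hG,
      ENNReal.mul_ne_top (ecurrentSum_ne_top hK ∅) (ENNReal.sum_ne_top.mpr fun j _ =>
        ENNReal.sum_ne_top.mpr fun j' _ => hE j j')⟩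
  -- pass to real numbers
  have hreal := ENNReal.toReal_mono hRHS hENN
  rw [ENNReal.toReal_mul, toReal_prod_ecurrentSum hK, toReal_ecurrentSum hK, ENNReal.toReal_add
      (ENNReal.mul_ne_top (ENNReal.pow_ne_top (ecurrentSum_ne_top hK ∅)) hG)
      (ENNReal.mul_ne_top (ecurrentSum_ne_top hK ∅) (ENNReal.sum_ne_top.mpr fun j _ =>
        ENNReal.sum_ne_top.mpr fun j' _ => hE j j')),
    ENNReal.toReal_mul, ENNReal.toReal_pow, toReal_ecurrentSum hK, ENNReal.toReal_mul, toReal_ecurrentSum hK,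
    ENNReal.toReal_sum (fun j _ => ENNReal.sum_ne_top.mpr fun j' _ => hE j j')] at hreal
  simp_rw [ENNReal.toReal_sum (fun j' _ => hE _ j'), ENNReal.toReal_mul, toReal_prod_ecurrentSum hK] at hreal
  rw [← hz] at hreal
  -- `hreal : (∏ j, Z_j) * z ≤ z ^ k * G + z * ∑∑ (∏ Z_i) * P`
  set Gr := (∑ δ : Fin k → XState G, if Good rk x τ δ then Jsum K x δ else 0).toReal with hGr
  -- identify the two-point functions and the interaction weights
  have hT : ∀ i, T2 K (x (τ (pairIdx k (i, 0)))) (x (τ (pairIdx k (i, 1)))) = wcurrentSum K (pairSrc x τ i) / z := by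
    intro i; rw [pairSrc_eq]; rfl
  have hP : ∀ j j', (Pint K (wA x τ j) (wB x τ j) (wA x τ j') (wB x τ j')).toReal =
      z ^ 2 * (|C4 K ![x (τ (pairIdx k (j, 0))), x (τ (pairIdx k (j, 1))), x (τ (pairIdx k (j', 0))), x (τ (pairIdx k (j', 1)))]| / 2) := by
    intro j j'
    obtain ⟨h1, h2⟩ := toReal_Pint_div_eq hK (wA x τ j) (wB x τ j) (wA x τ j') (wB x τ j')
    rw [← abs_C4_wA_wB_eq, abs_of_nonpos h2]
    rw [← hz] at h1
    have hz2 : z ^ 2 ≠ 0 := by positivity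
    field_simp at h1
    linarith [h1]
  -- the target, multiplied by `z^{k+1}`
  have hcard : ∀ j j' : Fin k, j' ∈ Finset.univ.filter (fun j' => j < j') → ((Finset.univ.erase j).erase j').card = k - 2 := by
    intro j j' hj'
    have hjj' : j ≠ j' := (Finset.mem_filter.mp hj').2.ne
    rw [Finset.card_erase_of_mem (Finset.mem_erase.mpr ⟨hjj'.symm, Finset.mem_univ _⟩), Finset.card_erase_of_mem (Finset.mem_univ _),
      Finset.card_univ, Fintype.card_fin]
    omega
  have hk2 : ∀ j j' : Fin k, j' ∈ Finset.univ.filter (fun j' => j < j') → 2 ≤ k := by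
    intro j j' hj'
    have := (Finset.mem_filter.mp hj').2
    have h1 := j.2; have h2 := j'.2
    omega
  rw [div_add' _ _ _ hzpos.ne', le_div_iff₀ hzpos]
  have hlhs : (∏ j, T2 K (x (τ (pairIdx k (j, 0)))) (x (τ (pairIdx k (j, 1))))) * z * z ^ k =
      (∏ j, wcurrentSum K (pairSrc x τ j)) * z := by
    simp_rw [hT]
    rw [Finset.prod_div_distrib, Finset.prod_const, Finset.card_univ, Fintype.card_fin]
    field_simp
  have hrhs : (Gr + 1 / 2 * (∑ j, ∑ j' ∈ Finset.univ.filter (fun j' => j < j'),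
      pairTerm (T2 K) (fun y => |C4 K y|) x j j' τ) * z) * z ^ k =
      z ^ k * Gr + z * ∑ j, ∑ j' ∈ Finset.univ.filter (fun j' => j < j'),
        (∏ i ∈ (Finset.univ.erase j).erase j', wcurrentSum K (pairSrc x τ i)) *
          (Pint K (wA x τ j) (wB x τ j) (wA x τ j') (wB x τ j')).toReal := by
    have hterm : ∀ j : Fin k, ∀ j' ∈ Finset.univ.filter (fun j' => j < j'),
        (∏ i ∈ (Finset.univ.erase j).erase j', wcurrentSum K (pairSrc x τ i)) *
            (Pint K (wA x τ j) (wB x τ j) (wA x τ j') (wB x τ j')).toReal =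
          1 / 2 * pairTerm (T2 K) (fun y => |C4 K y|) x j j' τ * z ^ k := by
      intro j j' hj'
      rw [hP, pairTerm]
      simp_rw [hT]
      rw [Finset.prod_div_distrib, Finset.prod_const, hcard j j' hj']
      obtain ⟨k', hk'⟩ : ∃ k', k = k' + 2 := ⟨k - 2, by have := hk2 j j' hj'; omega⟩
      subst hk'
      rw [show k' + 2 - 2 = k' by omega, pow_succ, pow_succ]
      field_simp
      ring
    rw [Finset.sum_congr rfl fun j _ => Finset.sum_congr rfl fun j' hj' => hterm j j' hj']
    simp_rw [← Finset.sum_mul, ← Finset.mul_sum]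
    ring
  calc (∏ j, T2 K (x (τ (pairIdx k (j, 0)))) (x (τ (pairIdx k (j, 1))))) * z
      = (∏ j, wcurrentSum K (pairSrc x τ j)) * z / z ^ k := by
        rw [eq_div_iff (by positivity), hlhs]
    _ ≤ (z ^ k * Gr + z * ∑ j, ∑ j' ∈ Finset.univ.filter (fun j' => j < j'),
        (∏ i ∈ (Finset.univ.erase j).erase j', wcurrentSum K (pairSrc x τ i)) *
          (Pint K (wA x τ j) (wB x τ j) (wA x τ j') (wB x τ j')).toReal) / z ^ k :=
        div_le_div_of_nonneg_right hreal (by positivity)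
    _ = (Gr + 1 / 2 * (∑ j, ∑ j' ∈ Finset.univ.filter (fun j' => j < j'),
        pairTerm (T2 K) (fun y => |C4 K y|) x j j' τ) * z) := by
        rw [eq_comm, eq_div_iff (by positivity), hrhs]

/-- **The injective case** (Aizenman 1982, Prop. 12.1 for `2n = 2(m+2)` distinct points, in terms of
normalised current sums): `𝒢_{m+2}[S₂](x) - S_{2m+4}(x) ≤ (3/2) ∑_s |U₄(x_s)| 𝒢_m[S₂](x^{(s̸)})` —
the per-ordering inequalities summed over all orderings (`2^{m+2}(m+2)!` times the pairing sum on the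
left), the multiplicity bound for the compatible part and the combinatorial conversion of the
interacting part. [cite: AizenmanCMP1982, Prop. 12.1, eq. (12.3) upper bound; proof (12.5)–(12.7)] -/
theorem pairingSum_le_of_injective (hK : ∀ e, 0 ≤ K e) (hrk : Function.Injective rk) {m : ℕ}
    (x : Fin (2 * (m + 2)) → V) (hx : Function.Injective x) :
    pairingSum (T2 K) (m + 2) x ≤ Sf K (oddSupport x) +
      3 / 2 * ∑ s : {s : Finset (Fin (2 * (m + 2))) // s.card = 4},
        |C4 K (restrictFour x s)| * pairingSum (T2 K) (m + 2 - 2) (removeFour₂ x s) := by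
  classical
  set z : ℝ := wcurrentSum K ∅ with hz
  have hzpos : 0 < z := wcurrentSum_empty_pos hK
  set N : ℝ := 2 ^ (m + 2) * (m + 2)! with hN
  have hNpos : 0 < N := by positivity
  -- sum the per-ordering inequalities
  have hsum := Finset.sum_le_sum fun τ (_ : τ ∈ (Finset.univ : Finset (Equiv.Perm (Fin (2 * (m + 2)))))) =>
    prod_T2_le_of_ordering (K := K) hK hrk x τ
  rw [Finset.sum_add_distrib, ← Finset.sum_div, ← Finset.mul_sum,
    sum_sum_sum_pairTerm_eq (T2 K) (fun y => |C4 K y|) (fun y π => by rw [C4_comp_perm]) x] at hsum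
  -- the left-hand side is `N · pairingSum`
  have hL : ∑ τ : Equiv.Perm (Fin (2 * (m + 2))), ∏ j : Fin (m + 2),
      T2 K (x (τ (pairIdx (m + 2) (j, 0)))) (x (τ (pairIdx (m + 2) (j, 1)))) = N * pairingSum (T2 K) (m + 2) x := by
    rw [pairingSum, hN, ← mul_assoc, mul_inv_cancel₀ (by positivity), one_mul]
  -- the compatible part
  have hGsum : ∑ τ : Equiv.Perm (Fin (2 * (m + 2))),
      (∑ δ : Fin (m + 2) → XState G, if Good rk x τ δ then Jsum K x δ else 0).toReal ≤ N * wcurrentSum K (oddSupport x) := by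
    have hfin : ∀ τ : Equiv.Perm (Fin (2 * (m + 2))),
        (∑ δ : Fin (m + 2) → XState G, if Good rk x τ δ then Jsum K x δ else 0) ≠ ⊤ := by
      intro τ
      refine ENNReal.sum_ne_top.mpr fun δ _ => ?_
      split_ifs
      · refine ne_top_of_le_ne_top (ecurrentSum_ne_top hK (oddSupport x)) ?_
        unfold Jsum ecurrentSum
        refine ENNReal.tsum_le_tsum fun m => ?_
        split_ifs with h1 h2 h2
        · exact le_rfl
        · exact absurd h1.1 h2
        · exact zero_le
        · exact le_rfl
      · exact ENNReal.zero_ne_top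
    rw [← ENNReal.toReal_sum fun τ _ => hfin τ]
    have hNtop : (2 ^ (m + 2) * ((m + 2)! : ℕ) : ℝ≥0∞) ≠ ⊤ :=
      ENNReal.mul_ne_top (ENNReal.pow_ne_top (by simp)) (ENNReal.natCast_ne_top _)
    have h := ENNReal.toReal_mono (ENNReal.mul_ne_top hNtop (ecurrentSum_ne_top hK _))
      (sum_sum_good_Jsum_le (K := K) hrk hx)
    rw [ENNReal.toReal_mul, toReal_ecurrentSum hK] at h
    have h2 : ((2 : ℝ≥0∞) ^ (m + 2) * ((m + 2)! : ℕ)).toReal = N := by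
      rw [hN, ENNReal.toReal_mul, ENNReal.toReal_pow, ENNReal.toReal_natCast, ENNReal.toReal_ofNat]
    rw [h2] at h
    exact h
  have hG' : (∑ τ : Equiv.Perm (Fin (2 * (m + 2))),
      (∑ δ : Fin (m + 2) → XState G, if Good rk x τ δ then Jsum K x δ else 0).toReal) / z ≤ N * Sf K (oddSupport x) := by
    rw [div_le_iff₀ hzpos, Sf, mul_assoc, div_mul_cancel₀ _ hzpos.ne']
    exact hGsum
  rw [hL] at hsum
  have key : N * pairingSum (T2 K) (m + 2) x ≤ N * (Sf K (oddSupport x) +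
      3 / 2 * ∑ s : {s : Finset (Fin (2 * (m + 2))) // s.card = 4},
        |C4 K (restrictFour x s)| * pairingSum (T2 K) (m + 2 - 2) (removeFour₂ x s)) := by
    refine hsum.trans ?_
    rw [mul_add N]
    refine add_le_add hG' (le_of_eq ?_)
    rw [hN]; ring
  exact le_of_mul_le_mul_left key hNpos

end PartE1

/-! ### Part D. Coincident points -/

/-! #### The pendant graph: coincident points as distinct pendant vertices

Aizenman: "The cases with coincidental points are easily reduced to this situation" (p. 37). We
attach to `G` one pendant vertex `inr i` per index `i`, joined to `x i`; with coupling `L > 0` on the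
pendant bonds every correlation of the pendant spins is an explicit multiple (a power of
`t = (∑_{odd} Lᵖ/p!)/(∑_{even} Lᵖ/p!)`) of the corresponding correlation of the points `x i`, so the
inequality for the (distinct) pendant vertices is the inequality for `x`. -/

section Pendant

variable (G) {M : ℕ} (x : Fin M → V)

/-- Adjacency of the pendant graph: `G` on the old vertices, and `inl (x i) — inr i`. [folklore] -/
def pendantAdj : V ⊕ Fin M → V ⊕ Fin M → Prop
  | Sum.inl u, Sum.inl v => G.Adj u v
  | Sum.inl u, Sum.inr i => x i = u
  | Sum.inr i, Sum.inl u => x i = u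
  | Sum.inr _, Sum.inr _ => False

/-- The pendant graph of `G` along the points `x`. [folklore] -/
def pendantGraph : SimpleGraph (V ⊕ Fin M) where
  Adj := pendantAdj G x
  symm := ⟨by
    rintro (u | i) (v | j) h
    · exact G.adj_symm h
    · exact h
    · exact h
    · exact h.elim⟩
  loopless := ⟨by
    rintro (u | i) h
    · exact G.loopless.irrefl u h
    · exact h⟩

/-- Adjacency of the pendant graph is decidable. [folklore] -/
instance pendantGraph.instDecidableRel : DecidableRel (pendantGraph G x).Adj := by
  rintro (u | i) (v | j)
  · change Decidable (G.Adj u v); infer_instance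
  · change Decidable (x j = u); infer_instance
  · change Decidable (x i = v); infer_instance
  · change Decidable False; infer_instance

variable {G x}

omit [Fintype V] [DecidableEq V] [DecidableRel G.Adj] in
/-- Adjacency of two old vertices. [folklore] -/
@[simp] theorem pendantGraph_adj_inl_inl {u v : V} : (pendantGraph G x).Adj (Sum.inl u) (Sum.inl v) ↔ G.Adj u v := Iff.rfl

omit [Fintype V] [DecidableEq V] [DecidableRel G.Adj] in
/-- Adjacency of an old vertex and a pendant vertex. [folklore] -/
@[simp] theorem pendantGraph_adj_inl_inr {u : V} {i : Fin M} : (pendantGraph G x).Adj (Sum.inl u) (Sum.inr i) ↔ x i = u := Iff.rfl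

omit [Fintype V] [DecidableEq V] [DecidableRel G.Adj] in
/-- Adjacency of a pendant vertex and an old vertex. [folklore] -/
@[simp] theorem pendantGraph_adj_inr_inl {u : V} {i : Fin M} : (pendantGraph G x).Adj (Sum.inr i) (Sum.inl u) ↔ x i = u := Iff.rfl

omit [Fintype V] [DecidableEq V] [DecidableRel G.Adj] in
/-- Pendant vertices are not adjacent. [folklore] -/
@[simp] theorem pendantGraph_adj_inr_inr {i j : Fin M} : ¬ (pendantGraph G x).Adj (Sum.inr i) (Sum.inr j) := id

variable (G x) in
/-- The bonds of the pendant graph: the old bonds and the pendant bonds. [folklore] -/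
def pendantEdge : G.edgeFinset ⊕ Fin M → (pendantGraph G x).edgeFinset
  | Sum.inl e => ⟨(e : Sym2 V).map Sum.inl, by
      obtain ⟨e, he⟩ := e
      induction e using Sym2.ind with
      | _ u v =>
        rw [SimpleGraph.mem_edgeFinset] at he ⊢
        exact he⟩
  | Sum.inr i => ⟨s(Sum.inl (x i), Sum.inr i), by rw [SimpleGraph.mem_edgeFinset]; exact rfl⟩

/-- `pendantEdge` is a bijection. [folklore] -/
theorem pendantEdge_bijective : Function.Bijective (pendantEdge G x) := by
  constructor
  · rintro (e | i) (e' | i') h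
    · simp only [pendantEdge, Subtype.mk.injEq] at h
      exact congrArg Sum.inl (Subtype.ext (Sym2.map.injective Sum.inl_injective h))
    · exfalso
      simp only [pendantEdge, Subtype.mk.injEq] at h
      have : (Sum.inr i' : V ⊕ Fin M) ∈ (e : Sym2 V).map Sum.inl := by rw [h]; exact Sym2.mem_mk_right _ _
      obtain ⟨a, -, ha⟩ := Sym2.mem_map.mp this
      exact Sum.inl_ne_inr ha
    · exfalso
      simp only [pendantEdge, Subtype.mk.injEq] at h
      have : (Sum.inr i : V ⊕ Fin M) ∈ (e' : Sym2 V).map Sum.inl := by rw [← h]; exact Sym2.mem_mk_right _ _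
      obtain ⟨a, -, ha⟩ := Sym2.mem_map.mp this
      exact Sum.inl_ne_inr ha
    · simp only [pendantEdge, Subtype.mk.injEq] at h
      have : (Sum.inr i : V ⊕ Fin M) ∈ s(Sum.inl (x i'), Sum.inr i') := by rw [← h]; exact Sym2.mem_mk_right _ _
      rcases Sym2.mem_iff.mp this with h1 | h1
      · exact absurd h1.symm Sum.inl_ne_inr
      · rw [Sum.inr_injective h1]
  · rintro ⟨e, he⟩
    induction e using Sym2.ind with
    | _ p q =>
      rw [SimpleGraph.mem_edgeFinset] at he
      rcases p with u | i <;> rcases q with v | j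
      · refine ⟨Sum.inl ⟨s(u, v), SimpleGraph.mem_edgeFinset.mpr he⟩, ?_⟩
        simp [pendantEdge]
      · have hx : x j = u := he
        exact ⟨Sum.inr j, by simp [pendantEdge, hx]⟩
      · have hx : x i = v := he
        exact ⟨Sum.inr i, by simp [pendantEdge, hx, Sym2.eq_swap]⟩
      · exact (pendantGraph_adj_inr_inr (G := G) (x := x) ((SimpleGraph.mem_edgeSet _).mp he)).elim

variable (G x) in
/-- The bonds of the pendant graph as old bonds plus pendant bonds. [folklore] -/
def pendantEdgeEquiv : G.edgeFinset ⊕ Fin M ≃ (pendantGraph G x).edgeFinset :=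
  Equiv.ofBijective (pendantEdge G x) pendantEdge_bijective

/-- Membership of an old vertex in an old bond. [folklore] -/
theorem inl_mem_pendantEdge_inl {w : V} {e : G.edgeFinset} :
    (Sum.inl w : V ⊕ Fin M) ∈ ((pendantEdge G x (Sum.inl e) : (pendantGraph G x).edgeFinset) : Sym2 (V ⊕ Fin M)) ↔
      w ∈ (e : Sym2 V) := by
  simp only [pendantEdge, Sym2.mem_map, Sum.inl.injEq, exists_eq_right]

/-- A pendant vertex is in no old bond. [folklore] -/
theorem inr_not_mem_pendantEdge_inl {i : Fin M} {e : G.edgeFinset} :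
    (Sum.inr i : V ⊕ Fin M) ∉ ((pendantEdge G x (Sum.inl e) : (pendantGraph G x).edgeFinset) : Sym2 (V ⊕ Fin M)) := by
  simp only [pendantEdge, Sym2.mem_map, not_exists, not_and]
  exact fun a _ h => Sum.inl_ne_inr h

/-- Membership of an old vertex in a pendant bond. [folklore] -/
theorem inl_mem_pendantEdge_inr {w : V} {i : Fin M} :
    (Sum.inl w : V ⊕ Fin M) ∈ ((pendantEdge G x (Sum.inr i) : (pendantGraph G x).edgeFinset) : Sym2 (V ⊕ Fin M)) ↔ x i = w := by
  simp only [pendantEdge, Sym2.mem_iff, Sum.inl.injEq, reduceCtorEq, or_false]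
  exact eq_comm

/-- Membership of a pendant vertex in a pendant bond. [folklore] -/
theorem inr_mem_pendantEdge_inr {j i : Fin M} :
    (Sum.inr j : V ⊕ Fin M) ∈ ((pendantEdge G x (Sum.inr i) : (pendantGraph G x).edgeFinset) : Sym2 (V ⊕ Fin M)) ↔ j = i := by
  simp only [pendantEdge, Sym2.mem_iff, reduceCtorEq, Sum.inr.injEq, false_or]

/-! #### Currents on the pendant graph -/

variable (G x) in
/-- A current of the pendant graph as an old current and the values on the pendant bonds. [folklore] -/
def pendantCurrentEquiv : Current (pendantGraph G x) ≃ Current G × (Fin M → ℕ) :=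
  (Equiv.arrowCongr (pendantEdgeEquiv G x) (Equiv.refl ℕ)).symm.trans
    (Equiv.sumArrowEquivProdArrow G.edgeFinset (Fin M) ℕ)

/-- The inverse of `pendantCurrentEquiv` on an old bond. [folklore] -/
theorem pendantCurrentEquiv_symm_apply_inl (n : Current G) (p : Fin M → ℕ) (e : G.edgeFinset) :
    (pendantCurrentEquiv G x).symm (n, p) (pendantEdgeEquiv G x (Sum.inl e)) = n e := by
  simp [pendantCurrentEquiv, Equiv.sumArrowEquivProdArrow, Equiv.arrowCongr]

/-- The inverse of `pendantCurrentEquiv` on a pendant bond. [folklore] -/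
theorem pendantCurrentEquiv_symm_apply_inr (n : Current G) (p : Fin M → ℕ) (i : Fin M) :
    (pendantCurrentEquiv G x).symm (n, p) (pendantEdgeEquiv G x (Sum.inr i)) = p i := by
  simp [pendantCurrentEquiv, Equiv.sumArrowEquivProdArrow, Equiv.arrowCongr]

variable (K : G.edgeFinset → ℝ) (L : ℝ)

variable (G x) in
/-- The couplings of the pendant graph: `K` on the old bonds, `L` on the pendant bonds. [folklore] -/
def pendantK : (pendantGraph G x).edgeFinset → ℝ := fun e' => Sum.elim K (fun _ => L) ((pendantEdgeEquiv G x).symm e')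

/-- `pendantK` on an old bond. [folklore] -/
@[simp] theorem pendantK_inl (e : G.edgeFinset) : pendantK G x K L (pendantEdgeEquiv G x (Sum.inl e)) = K e := by
  simp [pendantK]

/-- `pendantK` on a pendant bond. [folklore] -/
@[simp] theorem pendantK_inr (i : Fin M) : pendantK G x K L (pendantEdgeEquiv G x (Sum.inr i)) = L := by
  simp [pendantK]

variable {K L}

/-- `pendantK ≥ 0` for `K, L ≥ 0`. [folklore] -/
theorem pendantK_nonneg (hK : ∀ e, 0 ≤ K e) (hL : 0 ≤ L) : ∀ e', 0 ≤ pendantK G x K L e' := by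
  intro e'
  obtain ⟨q, rfl⟩ := (pendantEdgeEquiv G x).surjective e'
  rcases q with e | i
  · rw [pendantK_inl]; exact hK e
  · rw [pendantK_inr]; exact hL

/-- The weight of a pendant-graph current: the old weight times `∏ᵢ L^{pᵢ}/pᵢ!`. [folklore] -/
theorem wweight_pendant (n : Current G) (p : Fin M → ℕ) :
    ((pendantCurrentEquiv G x).symm (n, p)).wweight (pendantK G x K L) =
      n.wweight K * ∏ i, L ^ p i / ((p i)! : ℝ) := by
  unfold Current.wweight
  rw [← Fintype.prod_equiv (pendantEdgeEquiv G x) (fun q => pendantK G x K L (pendantEdgeEquiv G x q) ^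
      (pendantCurrentEquiv G x).symm (n, p) (pendantEdgeEquiv G x q) /
      (((pendantCurrentEquiv G x).symm (n, p) (pendantEdgeEquiv G x q))! : ℝ)) _ (fun _ => rfl),
    Fintype.prod_sum_type]
  simp only [pendantK_inl, pendantK_inr, pendantCurrentEquiv_symm_apply_inl, pendantCurrentEquiv_symm_apply_inr]

/-- The degree of an old vertex in a pendant-graph current. [folklore] -/
theorem degree_pendant_inl (n : Current G) (p : Fin M → ℕ) (w : V) :
    ((pendantCurrentEquiv G x).symm (n, p)).degree (Sum.inl w) = n.degree w + ∑ i, if x i = w then p i else 0 := by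
  unfold Current.degree
  rw [← Fintype.sum_equiv (pendantEdgeEquiv G x) (fun q => if (Sum.inl w : V ⊕ Fin M) ∈
      ((pendantEdgeEquiv G x q : (pendantGraph G x).edgeFinset) : Sym2 (V ⊕ Fin M))
      then (pendantCurrentEquiv G x).symm (n, p) (pendantEdgeEquiv G x q) else 0) _ (fun _ => rfl),
    Fintype.sum_sum_type]
  congr 1
  · refine Finset.sum_congr rfl fun e _ => ?_
    rw [pendantCurrentEquiv_symm_apply_inl]
    simp only [pendantEdgeEquiv, Equiv.ofBijective_apply, inl_mem_pendantEdge_inl]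
  · refine Finset.sum_congr rfl fun i _ => ?_
    rw [pendantCurrentEquiv_symm_apply_inr]
    simp only [pendantEdgeEquiv, Equiv.ofBijective_apply, inl_mem_pendantEdge_inr]

/-- The degree of a pendant vertex in a pendant-graph current. [folklore] -/
theorem degree_pendant_inr (n : Current G) (p : Fin M → ℕ) (i : Fin M) :
    ((pendantCurrentEquiv G x).symm (n, p)).degree (Sum.inr i) = p i := by
  unfold Current.degree
  rw [← Fintype.sum_equiv (pendantEdgeEquiv G x) (fun q => if (Sum.inr i : V ⊕ Fin M) ∈
      ((pendantEdgeEquiv G x q : (pendantGraph G x).edgeFinset) : Sym2 (V ⊕ Fin M))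
      then (pendantCurrentEquiv G x).symm (n, p) (pendantEdgeEquiv G x q) else 0) _ (fun _ => rfl),
    Fintype.sum_sum_type]
  have h1 : ∑ e : G.edgeFinset, (if (Sum.inr i : V ⊕ Fin M) ∈
      ((pendantEdgeEquiv G x (Sum.inl e) : (pendantGraph G x).edgeFinset) : Sym2 (V ⊕ Fin M))
      then (pendantCurrentEquiv G x).symm (n, p) (pendantEdgeEquiv G x (Sum.inl e)) else 0) = 0 :=
    Finset.sum_eq_zero fun e _ => by
      simp only [pendantEdgeEquiv, Equiv.ofBijective_apply]
      rw [if_neg inr_not_mem_pendantEdge_inl]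
  rw [h1, zero_add, Finset.sum_eq_single i (fun j _ hj => by
      simp only [pendantEdgeEquiv, Equiv.ofBijective_apply]
      rw [if_neg (fun h => hj.symm (inr_mem_pendantEdge_inr.mp h))]) (fun h => absurd (Finset.mem_univ i) h)]
  simp only [pendantEdgeEquiv, Equiv.ofBijective_apply]
  rw [if_pos (inr_mem_pendantEdge_inr.mpr rfl)]
  exact pendantCurrentEquiv_symm_apply_inr n p i

variable (x) in
/-- The set of old vertices hit an odd number of times by the indices of `I`: `Δ_{i ∈ I} {x i}`. [folklore] -/
def pendantOddSet (I : Finset (Fin M)) : Finset V := Finset.univ.filter fun w => Odd (I.filter fun i => x i = w).card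

/-- For all the indices, `pendantOddSet` is the odd support. [folklore] -/
theorem pendantOddSet_univ : pendantOddSet x Finset.univ = oddSupport x := rfl

/-- The indices with odd pendant current. [folklore] -/
def oddIdx (p : Fin M → ℕ) : Finset (Fin M) := Finset.univ.filter fun i => Odd (p i)

omit [Fintype V] in
/-- Parity of one term of `∑ᵢ 𝟙[x i = w] pᵢ`. [folklore] -/
theorem ite_mod_two_eq (p : Fin M → ℕ) (w : V) (i : Fin M) :
    (if x i = w then p i else 0) % 2 = if Odd (p i) ∧ x i = w then 1 else 0 := by
  by_cases hx : x i = w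
  · rw [if_pos hx]
    by_cases ho : Odd (p i)
    · rw [if_pos ⟨ho, hx⟩]; exact Nat.odd_iff.mp ho
    · rw [if_neg (fun h => ho h.1)]; exact Nat.even_iff.mp (Nat.not_odd_iff_even.mp ho)
  · rw [if_neg hx, if_neg (fun h => hx h.2)]

/-- Parity of `∑ᵢ 𝟙[x i = w] pᵢ`. [folklore] -/
theorem odd_sum_ite_iff (p : Fin M → ℕ) (w : V) :
    Odd (∑ i, if x i = w then p i else 0) ↔ w ∈ pendantOddSet x (oddIdx p) := by
  rw [pendantOddSet, Finset.mem_filter, and_iff_right (Finset.mem_univ w), oddIdx, Finset.filter_filter, Finset.card_filter,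
    Nat.odd_iff, Nat.odd_iff, Finset.sum_nat_mod, Finset.sum_congr rfl (fun i _ => ite_mod_two_eq p w i)]

/-- **The sources of a pendant-graph current**: pendant vertex `inr i` is a source iff `pᵢ` is odd;
old vertex `inl w` is a source iff `w ∈ ∂n Δ pendantOddSet x (oddIdx p)`. [folklore] -/
theorem mem_sources_pendant_iff (n : Current G) (p : Fin M → ℕ) (v : V ⊕ Fin M) :
    v ∈ ((pendantCurrentEquiv G x).symm (n, p)).sources ↔
      Sum.elim (fun w => w ∈ n.sources ∆ pendantOddSet x (oddIdx p)) (fun i => i ∈ oddIdx p) v := by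
  rcases v with w | i
  · rw [Current.mem_sources_iff, degree_pendant_inl, Sum.elim_inl, Finset.mem_symmDiff,
      Current.mem_sources_iff, ← odd_sum_ite_iff, Nat.odd_add, ← Nat.not_odd_iff_even]
    tauto
  · rw [Current.mem_sources_iff, degree_pendant_inr, Sum.elim_inr, oddIdx, Finset.mem_filter,
      and_iff_right (Finset.mem_univ i)]

/-- The source set `B ⊕ I` of the pendant graph. [folklore] -/
def sumSet (B : Finset V) (I : Finset (Fin M)) : Finset (V ⊕ Fin M) := B.disjSum I

omit [Fintype V] [DecidableEq V] in
/-- Membership in `sumSet`. [folklore] -/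
theorem mem_sumSet_iff {B : Finset V} {I : Finset (Fin M)} (v : V ⊕ Fin M) :
    v ∈ sumSet B I ↔ Sum.elim (fun w => w ∈ B) (fun i => i ∈ I) v := by
  rcases v with w | i <;> simp [sumSet, Finset.mem_disjSum]

/-- **The source condition on the pendant graph**: `∂n' = B ⊕ I` iff `oddIdx p = I` and `∂n = B Δ pendantOddSet x I`. [folklore] -/
theorem sources_pendant_eq_iff (n : Current G) (p : Fin M → ℕ) (B : Finset V) (I : Finset (Fin M)) :
    ((pendantCurrentEquiv G x).symm (n, p)).sources = sumSet B I ↔ oddIdx p = I ∧ n.sources = B ∆ pendantOddSet x I := by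
  constructor
  · intro h
    have hmem : ∀ v, v ∈ ((pendantCurrentEquiv G x).symm (n, p)).sources ↔ v ∈ sumSet B I := fun v => by rw [h]
    have hI : oddIdx p = I := by
      ext i
      have := hmem (Sum.inr i)
      rw [mem_sources_pendant_iff, mem_sumSet_iff] at this
      exact this
    refine ⟨hI, ?_⟩
    ext w
    have := hmem (Sum.inl w)
    rw [mem_sources_pendant_iff, mem_sumSet_iff, Sum.elim_inl, Sum.elim_inl, hI, Finset.mem_symmDiff] at this
    rw [Finset.mem_symmDiff]
    by_cases hw : w ∈ pendantOddSet x I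
    · simp only [hw, not_true_eq_false, and_false, false_or, true_and] at this ⊢
      tauto
    · simp only [hw, not_false_eq_true, and_true, false_and, or_false] at this ⊢
      tauto
  · rintro ⟨hI, hn⟩
    ext v
    rw [mem_sources_pendant_iff, mem_sumSet_iff, hI]
    rcases v with w | i
    · rw [Sum.elim_inl, Sum.elim_inl, hn, Finset.mem_symmDiff, Finset.mem_symmDiff]
      by_cases hw : w ∈ pendantOddSet x I
      · simp only [hw, not_true_eq_false, and_false, false_or]
        tauto
      · simp only [hw, not_false_eq_true, and_true, false_and, or_false]
    · rfl

/-! #### The current sums of the pendant graph -/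

/-- The weight of the pendant values, `∏ᵢ L^{pᵢ}/pᵢ!`, in `ℝ≥0∞`. [folklore] -/
def pendW (L : ℝ) (p : Fin M → ℕ) : ℝ≥0∞ := ∏ i, ENNReal.ofReal (L ^ p i / ((p i)! : ℝ))

/-- The total weight of the pendant values with odd set `I`. [folklore] -/
def Cfac (M : ℕ) (L : ℝ) (I : Finset (Fin M)) : ℝ≥0∞ := ∑' p : Fin M → ℕ, if oddIdx p = I then pendW L p else 0

/-- The one-bond sums `∑_{q odd} L^q/q!` and `∑_{q even} L^q/q!` in `ℝ≥0∞`. [folklore] -/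
def parityFac (L : ℝ) (odd : Bool) : ℝ≥0∞ := ∑' q : ℕ, if (Odd q ↔ odd = true) then ENNReal.ofReal (L ^ q / (q ! : ℝ)) else 0

/-- The weight of a pendant-graph current in `ℝ≥0∞`. [folklore] -/
theorem eweight_pendant (hK : ∀ e, 0 ≤ K e) (hL : 0 ≤ L) (n : Current G) (p : Fin M → ℕ) :
    ((pendantCurrentEquiv G x).symm (n, p)).eweight (pendantK G x K L) = n.eweight K * pendW L p := by
  unfold Current.eweight pendW
  rw [wweight_pendant, ENNReal.ofReal_mul (Current.wweight_nonneg hK n), ENNReal.ofReal_prod_of_nonneg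
    (fun i _ => by positivity)]

/-- **The current sums of the pendant graph factorise**: `Z'[B ⊕ I] = Cfac(I) · Z[B Δ pendantOddSet x I]`. [folklore] -/
theorem ecurrentSum_pendant (hK : ∀ e, 0 ≤ K e) (hL : 0 ≤ L) (B : Finset V) (I : Finset (Fin M)) :
    ecurrentSum (pendantK G x K L) (sumSet B I) = Cfac M L I * ecurrentSum K (B ∆ pendantOddSet x I) := by
  unfold ecurrentSum Cfac
  rw [← Equiv.tsum_eq (pendantCurrentEquiv G x).symm, mul_comm, tsum_mul_tsum_eq_tsum_prod]
  refine tsum_congr fun q => ?_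
  obtain ⟨n, p⟩ := q
  dsimp only
  rw [eweight_pendant hK hL]
  have hiff := sources_pendant_eq_iff (x := x) n p B I
  by_cases hI : oddIdx p = I
  · by_cases hn : n.sources = B ∆ pendantOddSet x I
    · rw [if_pos (hiff.mpr ⟨hI, hn⟩), if_pos hn, if_pos hI]
    · rw [if_neg (fun h => hn (hiff.mp h).2), if_neg hn, zero_mul]
  · rw [if_neg (fun h => hI (hiff.mp h).1), if_neg hI, mul_zero]

/-- **Fubini over the pendant values**: `∑_{p : Fin M → ℕ} ∏ᵢ fᵢ(pᵢ) = ∏ᵢ ∑_q fᵢ(q)`. [folklore] -/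
theorem tsum_pi_prod_eq : ∀ (M : ℕ) (f : Fin M → ℕ → ℝ≥0∞), ∑' p : Fin M → ℕ, ∏ i, f i (p i) = ∏ i, ∑' q, f i q
  | 0, f => by
    rw [tsum_eq_single (default : Fin 0 → ℕ) (fun p hp => absurd (Subsingleton.elim p default) hp)]
    simp
  | M + 1, f => by
    rw [← Equiv.tsum_eq (Fin.consEquiv fun _ => ℕ), ENNReal.tsum_prod', Fin.prod_univ_succ]
    have h : ∀ (a : ℕ) (g : Fin M → ℕ), ∏ i : Fin (M + 1), f i ((Fin.consEquiv fun _ => ℕ) (a, g) i) =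
        f 0 a * ∏ i : Fin M, f i.succ (g i) := by
      intro a g
      rw [Fin.prod_univ_succ]
      rfl
    simp_rw [h, ENNReal.tsum_mul_left, ENNReal.tsum_mul_right]
    rw [tsum_pi_prod_eq M (fun i => f i.succ)]

/-- **Product structure of `Cfac`**: `Cfac(I) = ∏ᵢ (odd-sum if i ∈ I, even-sum otherwise)`. [folklore] -/
theorem Cfac_eq_prod (L : ℝ) (I : Finset (Fin M)) :
    Cfac M L I = ∏ i, parityFac L (decide (i ∈ I)) := by
  unfold Cfac parityFac
  rw [← tsum_pi_prod_eq]
  refine tsum_congr fun p => ?_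
  by_cases h : oddIdx p = I
  · rw [if_pos h, pendW]
    refine Finset.prod_congr rfl fun i _ => ?_
    have hi : Odd (p i) ↔ decide (i ∈ I) = true := by
      rw [decide_eq_true_iff, ← h]; simp [oddIdx]
    rw [if_pos hi]
  · rw [if_neg h]
    obtain ⟨i, hi⟩ : ∃ i, ¬ (Odd (p i) ↔ decide (i ∈ I) = true) := by
      by_contra hc
      push Not at hc
      apply h
      ext i
      have := hc i
      rw [decide_eq_true_iff] at this
      rw [← this]; simp [oddIdx]
    exact (Finset.prod_eq_zero (Finset.mem_univ i) (if_neg hi)).symm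

/-- The parity sums are finite (bounded by `e^{|L|}`-type series). [folklore] -/
theorem parityFac_ne_top (L : ℝ) (b : Bool) : parityFac L b ≠ ⊤ := by
  have hsum : Summable fun q : ℕ => |L| ^ q / (q ! : ℝ) := (NormedSpace.expSeries_div_hasSum_exp |L|).summable
  have hle : parityFac L b ≤ ∑' q : ℕ, ENNReal.ofReal (|L| ^ q / (q ! : ℝ)) := by
    unfold parityFac
    refine ENNReal.tsum_le_tsum fun q => ?_
    split_ifs
    · refine ENNReal.ofReal_le_ofReal (div_le_div_of_nonneg_right ?_ (by positivity))
      rw [← abs_pow]; exact le_abs_self _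
    · exact zero_le
  refine ne_top_of_le_ne_top ?_ hle
  rw [← ENNReal.ofReal_tsum_of_nonneg (fun q => by positivity) hsum]
  exact ENNReal.ofReal_ne_top

/-- The even parity sum is at least `1` (the term `q = 0`). [folklore] -/
theorem one_le_parityFac_false (L : ℝ) : 1 ≤ parityFac L false := by
  unfold parityFac
  refine le_trans (le_of_eq ?_) (ENNReal.le_tsum 0)
  simp

/-- The odd parity sum is at least `L` (the term `q = 1`). [folklore] -/
theorem ofReal_le_parityFac_true (L : ℝ) : ENNReal.ofReal L ≤ parityFac L true := by
  unfold parityFac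
  refine le_trans (le_of_eq ?_) (ENNReal.le_tsum 1)
  simp

/-- `Cfac` is finite. [folklore] -/
theorem Cfac_ne_top (L : ℝ) (I : Finset (Fin M)) : Cfac M L I ≠ ⊤ := by
  rw [Cfac_eq_prod]
  exact ENNReal.prod_ne_top fun i _ => parityFac_ne_top L _

/-- `Cfac` in real terms: `so^{|I|} se^{M-|I|}`. [folklore] -/
theorem toReal_Cfac (L : ℝ) (I : Finset (Fin M)) :
    (Cfac M L I).toReal = (parityFac L true).toReal ^ I.card * (parityFac L false).toReal ^ (M - I.card) := by
  rw [Cfac_eq_prod, ENNReal.toReal_prod]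
  have h : ∀ i : Fin M, (parityFac L (decide (i ∈ I))).toReal =
      if i ∈ I then (parityFac L true).toReal else (parityFac L false).toReal := by
    intro i; by_cases hi : i ∈ I <;> simp [hi]
  simp_rw [h]
  rw [Finset.prod_ite, Finset.prod_const, Finset.prod_const, Finset.filter_mem_eq_inter, Finset.univ_inter]
  congr 2
  rw [Finset.filter_not, Finset.filter_mem_eq_inter, Finset.univ_inter, ← Finset.compl_eq_univ_sdiff, Finset.card_compl,
    Fintype.card_fin]

/-! #### The correlations of the pendant vertices are multiples of those of the points -/

/-- The ratio `t = (∑_{odd} L^q/q!)/(∑_{even} L^q/q!)` of the pendant bond. [folklore] -/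
def pendT (L : ℝ) : ℝ := (parityFac L true).toReal / (parityFac L false).toReal

/-- `se > 0`. [folklore] -/
theorem parityFac_false_toReal_pos (L : ℝ) : 0 < (parityFac L false).toReal :=
  ENNReal.toReal_pos (ne_of_gt (lt_of_lt_of_le zero_lt_one (one_le_parityFac_false L))) (parityFac_ne_top L _)

/-- `t > 0` for `L > 0`. [folklore] -/
theorem pendT_pos {L : ℝ} (hL : 0 < L) : 0 < pendT L := by
  refine div_pos (ENNReal.toReal_pos (ne_of_gt (lt_of_lt_of_le ?_ (ofReal_le_parityFac_true L))) (parityFac_ne_top L _))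
    (parityFac_false_toReal_pos L)
  exact ENNReal.ofReal_pos.mpr hL

/-- `pendantOddSet x ∅ = ∅`. [folklore] -/
theorem pendantOddSet_empty : pendantOddSet x (∅ : Finset (Fin M)) = ∅ := by
  unfold pendantOddSet; simp

omit [Fintype V] [DecidableEq V] in
/-- The empty source set of the pendant graph. [folklore] -/
theorem sumSet_empty_empty : sumSet (∅ : Finset V) (∅ : Finset (Fin M)) = ∅ := by
  unfold sumSet; simp

/-- **Normalised current sums of pendant vertices**: `Sf'(∅ ⊕ I) = t^{|I|} Sf(pendantOddSet x I)`. [folklore] -/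
theorem Sf_pendant (hK : ∀ e, 0 ≤ K e) (hL : 0 < L) (I : Finset (Fin M)) :
    Sf (pendantK G x K L) (sumSet ∅ I) = pendT L ^ I.card * Sf K (pendantOddSet x I) := by
  have hK' := pendantK_nonneg (x := x) hK hL.le
  unfold Sf
  rw [← toReal_ecurrentSum hK', ← toReal_ecurrentSum hK', ← sumSet_empty_empty, ecurrentSum_pendant hK hL.le,
    ecurrentSum_pendant hK hL.le, ENNReal.toReal_mul, ENNReal.toReal_mul, toReal_Cfac, toReal_Cfac, pendantOddSet_empty,
    Finset.card_empty, pow_zero, one_mul, Nat.sub_zero, empty_symmDiff, empty_symmDiff, toReal_ecurrentSum hK,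
    toReal_ecurrentSum hK, pendT]
  have hse := parityFac_false_toReal_pos L
  have hZ := wcurrentSum_empty_pos (G := G) hK
  have hIM : I.card ≤ M := by simpa using Finset.card_le_univ I
  have hpow : (parityFac L false).toReal ^ (M - I.card) * (parityFac L false).toReal ^ I.card =
      (parityFac L false).toReal ^ M := pow_sub_mul_pow _ hIM
  rw [div_pow, div_mul_div_comm, div_eq_div_iff (by positivity) (by positivity), ← hpow]
  ring

omit [Fintype V] in
/-- Sources of two pendant vertices. [folklore] -/
theorem singleton_symmDiff_inr (i j : Fin M) :
    ({Sum.inr i} : Finset (V ⊕ Fin M)) ∆ {Sum.inr j} = sumSet ∅ ({i} ∆ {j}) := by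
  ext v
  rw [mem_sumSet_iff]
  rcases v with w | k <;> simp [Finset.mem_symmDiff]

omit [Fintype V] [DecidableEq V] in
/-- `{i} Δ {j} = {i, j}` for `i ≠ j`. [folklore] -/
theorem singleton_symmDiff_singleton_eq_pair {i j : Fin M} (hij : i ≠ j) : ({i} ∆ {j} : Finset (Fin M)) = {i, j} := by
  ext k
  simp only [Finset.mem_symmDiff, Finset.mem_singleton, Finset.mem_insert]
  constructor
  · rintro (⟨h, -⟩ | ⟨h, -⟩)
    · exact Or.inl h
    · exact Or.inr h
  · rintro (rfl | rfl)
    · exact Or.inl ⟨rfl, hij⟩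
    · exact Or.inr ⟨rfl, fun h => hij h.symm⟩

/-- `pendantOddSet x ({i} ∆ {j}) = {x i} ∆ {x j}`. [folklore] -/
theorem pendantOddSet_pair (i j : Fin M) : pendantOddSet x ({i} ∆ {j}) = {x i} ∆ {x j} := by
  by_cases hij : i = j
  · subst hij
    rw [symmDiff_self, symmDiff_self, Finset.bot_eq_empty, Finset.bot_eq_empty, pendantOddSet_empty]
  ext w
  rw [pendantOddSet, Finset.mem_filter, and_iff_right (Finset.mem_univ w), singleton_symmDiff_singleton_eq_pair hij,
    Finset.card_filter, Finset.sum_pair hij, Finset.mem_symmDiff, Finset.mem_singleton, Finset.mem_singleton]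
  by_cases hi : x i = w <;> by_cases hj : x j = w
  · rw [if_pos hi, if_pos hj]
    constructor
    · intro h; exact absurd h (by decide)
    · rintro (⟨-, h⟩ | ⟨-, h⟩)
      · exact absurd hj.symm h
      · exact absurd hi.symm h
  · rw [if_pos hi, if_neg hj]
    exact ⟨fun _ => Or.inl ⟨hi.symm, fun h => hj h.symm⟩, fun _ => odd_one⟩
  · rw [if_neg hi, if_pos hj]
    exact ⟨fun _ => Or.inr ⟨hj.symm, fun h => hi h.symm⟩, fun _ => odd_one⟩
  · rw [if_neg hi, if_neg hj]
    constructor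
    · intro h; exact absurd h (by decide)
    · rintro (⟨h, -⟩ | ⟨h, -⟩)
      · exact absurd h.symm hi
      · exact absurd h.symm hj

/-- **Two-point functions of pendant vertices**: `S'(inr i, inr j) = t² S(x i, x j)` for `i ≠ j`. [folklore] -/
theorem T2_pendant (hK : ∀ e, 0 ≤ K e) (hL : 0 < L) {i j : Fin M} (hij : i ≠ j) :
    T2 (pendantK G x K L) (Sum.inr i) (Sum.inr j) = pendT L ^ 2 * T2 K (x i) (x j) := by
  unfold T2
  rw [singleton_symmDiff_inr, Sf_pendant hK hL, pendantOddSet_pair, singleton_symmDiff_singleton_eq_pair hij,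
    Finset.card_pair hij]

/-- **Pairing sums of pendant vertices**: `𝒢_n[S'](inr ∘ g) = t^{2n} 𝒢_n[S](x ∘ g)` for injective `g`. [folklore] -/
theorem pairingSum_pendant (hK : ∀ e, 0 ≤ K e) (hL : 0 < L) {n : ℕ} {g : Fin (2 * n) → Fin M} (hg : Function.Injective g) :
    pairingSum (T2 (pendantK G x K L)) n (Sum.inr ∘ g) = pendT L ^ (2 * n) * pairingSum (T2 K) n (x ∘ g) := by
  unfold pairingSum
  rw [Finset.mul_sum, Finset.mul_sum, Finset.mul_sum]
  refine Finset.sum_congr rfl fun τ _ => ?_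
  have h : ∀ j : Fin n, T2 (pendantK G x K L) ((Sum.inr ∘ g) (τ (pairIdx n (j, 0)))) ((Sum.inr ∘ g) (τ (pairIdx n (j, 1)))) =
      pendT L ^ 2 * T2 K ((x ∘ g) (τ (pairIdx n (j, 0)))) ((x ∘ g) (τ (pairIdx n (j, 1)))) := by
    intro j
    simp only [Function.comp_apply]
    exact T2_pendant hK hL (fun h => apply_pairIdx_zero_ne (τ := τ) j (hg h))
  simp_rw [h]
  rw [Finset.prod_mul_distrib, Finset.prod_const, Finset.card_univ, Fintype.card_fin, ← pow_mul]
  ring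

/-- The odd support of pendant vertices indexed injectively. [folklore] -/
theorem oddSupport_inr_comp {m : ℕ} {e : Fin m → Fin M} (he : Function.Injective e) :
    oddSupport (Sum.inr ∘ e : Fin m → V ⊕ Fin M) = sumSet ∅ (Finset.univ.image e) := by
  ext v
  rw [mem_sumSet_iff, oddSupport, Finset.mem_filter, and_iff_right (Finset.mem_univ v)]
  rcases v with w | i
  · simp
  · simp only [Function.comp_apply, Sum.inr.injEq, Sum.elim_inr, Finset.mem_image, Finset.mem_univ, true_and]
    by_cases h : ∃ k, e k = i
    · obtain ⟨k, rfl⟩ := h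
      have : (Finset.univ.filter fun a => e a = e k) = {k} := by
        ext a; simp [he.eq_iff]
      rw [this, Finset.card_singleton]
      exact ⟨fun _ => ⟨k, rfl⟩, fun _ => odd_one⟩
    · have : (Finset.univ.filter fun a => e a = i) = ∅ :=
        Finset.filter_eq_empty_iff.mpr fun a _ ha => h ⟨a, ha⟩
      rw [this, Finset.card_empty]
      exact ⟨fun h0 => absurd h0 (by decide), fun h' => absurd h' h⟩

/-- `pendantOddSet x (image e) = oddSupport (x ∘ e)` for injective `e`. [folklore] -/
theorem pendantOddSet_image {m : ℕ} {e : Fin m → Fin M} (he : Function.Injective e) :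
    pendantOddSet x (Finset.univ.image e) = oddSupport (x ∘ e) := by
  ext w
  rw [pendantOddSet, oddSupport, Finset.mem_filter, Finset.mem_filter, and_iff_right (Finset.mem_univ w),
    and_iff_right (Finset.mem_univ w), Finset.filter_image, Finset.card_image_of_injective _ he]
  rfl

/-- **Correlations of pendant vertices**: `Sf'(oddSupport (inr ∘ e)) = t^m Sf(oddSupport (x ∘ e))` for injective
`e : Fin m → Fin M`. [folklore] -/
theorem Sf_oddSupport_pendant (hK : ∀ e, 0 ≤ K e) (hL : 0 < L) {m : ℕ} {e : Fin m → Fin M} (he : Function.Injective e) :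
    Sf (pendantK G x K L) (oddSupport (Sum.inr ∘ e : Fin m → V ⊕ Fin M)) = pendT L ^ m * Sf K (oddSupport (x ∘ e)) := by
  rw [oddSupport_inr_comp he, Sf_pendant hK hL, pendantOddSet_image he, Finset.card_image_of_injective _ he, Finset.card_univ,
    Fintype.card_fin]

/-- **`U₄` of pendant vertices**: `U₄'(inr ∘ e) = t⁴ U₄(x ∘ e)` for injective `e : Fin 4 → Fin M`. [folklore] -/
theorem C4_pendant (hK : ∀ e, 0 ≤ K e) (hL : 0 < L) {e : Fin 4 → Fin M} (he : Function.Injective e) :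
    C4 (pendantK G x K L) (Sum.inr ∘ e) = pendT L ^ 4 * C4 K (x ∘ e) := by
  unfold C4 M3
  rw [Sf_oddSupport_pendant hK hL he]
  simp only [Function.comp_apply]
  rw [T2_pendant hK hL (he.ne (by decide)), T2_pendant hK hL (he.ne (by decide)), T2_pendant hK hL (he.ne (by decide)),
    T2_pendant hK hL (he.ne (by decide)), T2_pendant hK hL (he.ne (by decide)), T2_pendant hK hL (he.ne (by decide))]
  ring

/-! #### The inequality for arbitrary points -/

/-- **Aizenman 1982, Prop. 12.1 for arbitrary (possibly coincident) points, normalised current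
sums** ("The cases with coincidental points are easily reduced to this situation", p. 37: apply the
injective case to the pendant vertices of the pendant graph with unit pendant coupling, whose
correlations are `t^{#points}` times those of the points):
`𝒢_{m+2}[S₂](x) - S(x) ≤ (3/2) ∑_s |U₄(x_s)| 𝒢_m[S₂](x^{(s̸)})`. [cite: AizenmanCMP1982, Prop. 12.1 and p. 37 (coincident points)] -/
theorem pairingSum_le (hK : ∀ e, 0 ≤ K e) {m : ℕ} (x : Fin (2 * (m + 2)) → V) :
    pairingSum (T2 K) (m + 2) x ≤ Sf K (oddSupport x) +
      3 / 2 * ∑ s : {s : Finset (Fin (2 * (m + 2))) // s.card = 4},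
        |C4 K (restrictFour x s)| * pairingSum (T2 K) (m + 2 - 2) (removeFour₂ x s) := by
  classical
  have hL : (0 : ℝ) < 1 := one_pos
  have hK' := pendantK_nonneg (x := x) (K := K) hK hL.le
  set rk' : (pendantGraph G x).edgeFinset → ℕ := fun e => (Fintype.equivFin _ e : ℕ) with hrk'
  have hinj : Function.Injective rk' := fun e e' h => (Fintype.equivFin _).injective (Fin.ext h)
  have key := pairingSum_le_of_injective (K := pendantK G x K 1) hK' hinj
    (Sum.inr : Fin (2 * (m + 2)) → V ⊕ Fin (2 * (m + 2))) Sum.inr_injective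
  set t : ℝ := pendT 1 with ht
  have htpos : 0 < t := pendT_pos hL
  -- the three scalings
  have h1 : pairingSum (T2 (pendantK G x K 1)) (m + 2) (Sum.inr : Fin (2 * (m + 2)) → V ⊕ Fin (2 * (m + 2))) =
      t ^ (2 * (m + 2)) * pairingSum (T2 K) (m + 2) x :=
    pairingSum_pendant (x := x) hK hL (g := id) Function.injective_id
  have h2 : Sf (pendantK G x K 1) (oddSupport (Sum.inr : Fin (2 * (m + 2)) → V ⊕ Fin (2 * (m + 2)))) =
      t ^ (2 * (m + 2)) * Sf K (oddSupport x) :=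
    Sf_oddSupport_pendant (x := x) hK hL (e := id) Function.injective_id
  have h3 : ∀ s : {s : Finset (Fin (2 * (m + 2))) // s.card = 4},
      |C4 (pendantK G x K 1) (restrictFour (Sum.inr : Fin (2 * (m + 2)) → V ⊕ Fin (2 * (m + 2))) s)| *
        pairingSum (T2 (pendantK G x K 1)) (m + 2 - 2) (removeFour₂ (Sum.inr : Fin (2 * (m + 2)) → V ⊕ Fin (2 * (m + 2))) s) =
      t ^ (2 * (m + 2)) * (|C4 K (restrictFour x s)| * pairingSum (T2 K) (m + 2 - 2) (removeFour₂ x s)) := by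
    intro s
    have hC : C4 (pendantK G x K 1) (restrictFour (Sum.inr : Fin (2 * (m + 2)) → V ⊕ Fin (2 * (m + 2))) s) =
        t ^ 4 * C4 K (restrictFour x s) :=
      C4_pendant (x := x) hK hL (e := s.1.orderEmbOfFin s.2) (s.1.orderEmbOfFin s.2).injective
    have hP : pairingSum (T2 (pendantK G x K 1)) (m + 2 - 2) (removeFour₂ (Sum.inr : Fin (2 * (m + 2)) → V ⊕ Fin (2 * (m + 2))) s) =
        t ^ (2 * (m + 2 - 2)) * pairingSum (T2 K) (m + 2 - 2) (removeFour₂ x s) :=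
      pairingSum_pendant (x := x) hK hL (g := s.1ᶜ.orderEmbOfFin (card_compl_of_card_eq_four s) ∘ Fin.cast (two_mul_sub_two (m + 2)))
        ((s.1ᶜ.orderEmbOfFin (card_compl_of_card_eq_four s)).injective.comp (Fin.cast_injective _))
    rw [hC, hP, abs_mul, abs_of_pos (pow_pos htpos 4)]
    have : t ^ 4 * t ^ (2 * (m + 2 - 2)) = t ^ (2 * (m + 2)) := by
      rw [← pow_add]; congr 1; omega
    rw [← this]; ring
  rw [h1, h2, Finset.sum_congr rfl fun s _ => h3 s, ← Finset.mul_sum] at key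
  have key' : t ^ (2 * (m + 2)) * pairingSum (T2 K) (m + 2) x ≤ t ^ (2 * (m + 2)) * (Sf K (oddSupport x) +
      3 / 2 * ∑ s : {s : Finset (Fin (2 * (m + 2))) // s.card = 4},
        |C4 K (restrictFour x s)| * pairingSum (T2 K) (m + 2 - 2) (removeFour₂ x s)) := by
    refine key.trans (le_of_eq ?_); ring
  exact le_of_mul_le_mul_left key' (pow_pos htpos _)

end Pendant





/-! ### Part E₂. The discharge -/

section PartE2

variable (G)

/-- The free two-point function on a finite graph is the normalised current sum `T2` (uniform coupling). [cite: DuminilCopin2016, §2.1  eq. (2.2)] -/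
theorem twoPoint_free_eq_T2 (β : ℝ) (u v : V) :
    twoPoint (isingMeasure G univ β 0 .free) spinAt u v = T2 (fun _ : G.edgeFinset => β) u v := by
  rw [twoPoint_isingMeasure, isingTwoPoint_free_eq_currentSum_div_holds, currentSum_eq_wcurrentSum, currentSum_eq_wcurrentSum]
  rfl

/-- The free `n`-point function on a finite graph is `Sf` of the odd support (uniform coupling). [cite: DuminilCopin2016, §2.1  eq. (2.2)] -/
theorem nPoint_free_eq_Sf (β : ℝ) {n : ℕ} (y : Fin n → V) :
    nPoint (isingMeasure G univ β 0 .free) spinAt y = Sf (fun _ : G.edgeFinset => β) (oddSupport y) := by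
  rw [nPoint_univ_free_eq_isingCorr, isingCorr_free_eq_currentSum_div_holds, currentSum_eq_wcurrentSum,
    currentSum_eq_wcurrentSum]
  rfl

/-- The free Ursell four-point function on a finite graph is `C4` (uniform coupling). [folklore] -/
theorem connectedFour_free_eq_C4 (β : ℝ) (y : Fin 4 → V) :
    connectedFour (isingMeasure G univ β 0 .free) spinAt y = C4 (fun _ : G.edgeFinset => β) y := by
  rw [connectedFour, nPoint_free_eq_Sf, twoPoint_free_eq_T2, twoPoint_free_eq_T2, twoPoint_free_eq_T2, twoPoint_free_eq_T2,
    twoPoint_free_eq_T2, twoPoint_free_eq_T2, C4, M3]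
  ring

variable {G}

/-- Pairing sums of a non-negative two-point function are non-negative (local copy of
`PairIsing.pairingSum_nonneg'` of `TreeGraphWickPairInteraction.lean`, not imported here). [folklore] -/
private theorem pairingSum_nonneg_of_nonneg {α : Type*} {S : α → α → ℝ} (hS : ∀ a b, 0 ≤ S a b) (n : ℕ) (y : Fin (2 * n) → α) :
    0 ≤ pairingSum S n y :=
  mul_nonneg (inv_nonneg.mpr (by positivity)) (Finset.sum_nonneg fun _ _ => Finset.prod_nonneg fun _ _ => hS _ _)

/-- **Discharge of `aizenman_wickDeviation_le_finite`** (M. Aizenman, Comm. Math. Phys. 86 (1982),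
Prop. 12.1, eq. (12.3), upper bound): for the nearest-neighbour Ising model with unit couplings on any
finite simple graph, free boundary condition, zero field, `β ≥ 0`, `n ≥ 2` and any `x : Fin (2n) → V`,
`|S_{2n}(x) - 𝒢_n[S₂](x)| ≤ (3/2) R_{2n}(x)`. The upper inequality `𝒢_n - S_{2n} ≤ (3/2) R_{2n}` is
`pairingSum_le` (random-walk representation of §9 realised by the deterministic exploration of the
currents, §12 (12.5)–(12.7), coincident points through the pendant graph); the lower one is Newman's
Gaussian inequality `S_{2n} ≤ 𝒢_n` (`nPoint_le_pairingSum_univ_free`) together with `R_{2n} ≥ 0`.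
[cite: AizenmanCMP1982, Prop. 12.1, eq. (12.3) upper bound (p. 37), proof (12.5)–(12.7)] -/
theorem aizenman_wickDeviation_le_finite_holds : aizenman_wickDeviation_le_finite := by
  intro V _ _ G _ β hβ n hn x
  obtain ⟨m, rfl⟩ : ∃ m, n = m + 2 := ⟨n - 2, by omega⟩
  have hK : ∀ e : G.edgeFinset, 0 ≤ (fun _ : G.edgeFinset => β) e := fun _ => hβ
  have hT : twoPoint (isingMeasure G univ β 0 .free) spinAt = T2 (fun _ : G.edgeFinset => β) :=
    funext fun u => funext fun v => twoPoint_free_eq_T2 G β u v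
  have hC : connectedFour (isingMeasure G univ β 0 .free) spinAt = C4 (fun _ : G.edgeFinset => β) :=
    funext fun y => connectedFour_free_eq_C4 G β y
  have hR : 0 ≤ wickRemainder (twoPoint (isingMeasure G univ β 0 .free) spinAt)
      (connectedFour (isingMeasure G univ β 0 .free) spinAt) (m + 2) x := by
    rw [hT]
    exact Finset.sum_nonneg fun s _ => mul_nonneg (abs_nonneg _) (pairingSum_nonneg_of_nonneg (T2_nonneg hK) _ _)
  rw [abs_sub_le_iff]
  constructor
  · have h1 := nPoint_le_pairingSum_univ_free G hβ (m + 2) x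
    linarith
  · have h := pairingSum_le (K := fun _ : G.edgeFinset => β) hK x
    rw [hT, hC, nPoint_free_eq_Sf]
    unfold wickRemainder
    linarith

end PartE2

end Literature.Probability.LatticeModels

end
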